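import Literature.NumberTheory.GaloisRepresentations.H1VanishingCyclicSylow
import Literature.NumberTheory.GaloisRepresentations.PrimeDegreePrimitiveQuasisimple
import Literature.GroupTheory.SpecificGroups.AlternatingSixPSL2Nine
import Mathlib.LinearAlgebra.Matrix.CharP
import HarnessLib

/-!
# A Sylow `p`-subgroup of order `p` acts freely in degree `p` (GHT 2017, Lemma 6.2), classification-free

Topic `NumberTheory/GaloisRepresentations`; a sibling of `AdequacyDegreeP.lean` (the named fact
`ght2017_adequate_or_index_p_or_psl29` = Guralnick–Herzig–Tiep 2017, Thm 1.7),
`H1VanishingCyclicSylow.lean` (clause (ii) of adequacy for a `p`-element acting FREELY, GHT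
Lemmas 6.2–6.3 mechanism) and `PrimeDegreePrimitiveQuasisimple.lean` (the primitive branch reduced
to GHT Theorem 2.2's input, `ght2017_adequate_or_index_p_or_psl29_of_socle_odd`).  Theorems only;
no new definition, no named fact.

GHT use, in every case of Theorem 6.15 with a Sylow `p`-subgroup of order `p`,

> Lemma 6.2. Let `G` be a finite group with a Sylow `p`-subgroup `P` of order `p` and let
> `V ∈ IBr_p(G)` be such that `p ∣ dim V`. Then `V` is projective.

proved there by the Green correspondence and the structure of blocks with cyclic defect groups
([HL]).  For `dim V = p` — the case of Theorem 1.7 — "projective" means that `V` is free of rank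
one over `kP`, i.e. a generator `y` of `P` is ONE Jordan block (permutes a basis cyclically), and
THIS is proved here by linear algebra (`PrimeDegreeClifford.exists_cyclicBasis_of_not_sq_dvd`):

* `PrimeDegreeClifford.trace_eq_zero_of_commute_of_index` — RELATIVE TRACE: for a finite
  `H ≤ GL_n(K)` with scalar commutant (Schur), `n = 0` in `K`, and `Q ≤ H` of index invertible in
  `K`, every matrix `θ` commuting with `Q` has `tr θ = 0` (the average `Σ_{gQ} g θ g⁻¹` commutes
  with `H`, so is a scalar `c · 1` of trace `n c = 0`, and its trace is `[H : Q] tr θ`).  The case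
  `Q = 1`, `θ = E₁₁` is `p ∣ |H|` (`PrimeDegreeClifford.cast_card_eq_zero_of_isIrreducible`).
* `PrimeDegreeClifford.mul_jordanSplitting_comm`, `trace_jordanSplitting` — for `N^{m} = 0` the
  splitting endomorphism `θ = Σ_{j<m} N^j C R N^{m-1-j}` of a top Jordan block commutes with `N`
  and has trace `m · (R N^{m-1} C)`.
* `PrimeDegreeClifford.exists_cyclicBasis_of_not_sq_dvd` — `H ≤ GL_p(K)` finite with scalar
  commutant, `char K = p`, `p² ∤ |H|`, `y ∈ H` of order `p`: with `Q = ⟨y⟩` (index `|H|/p`, prime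
  to `p`) and `N = y - 1`, if `N^{p-1} = 0` the nilpotency index `m` of `N` is `< p`, so `m ≠ 0` in
  `K` and some `θ` above has non-zero trace — contradiction; hence `N^{p-1} ≠ 0`, a column of it
  is a cyclic vector (`linearIndependent_pow_mulVec`, `linearIndependent_pow_mulVec_of_sub_one`),
  and `exists_cyclicBasis_of_linearIndependent` gives the cyclic basis.
* `Subgroup.exists_cyclicBasis_of_isAbsIrreducible` (any field of characteristic `p`, `H`
  absolutely irreducible: Schur from Burnside spanning, `exists_eq_smul_one_of_span_eq_top`) and
  `Subgroup.exists_cyclicBasis_of_isIrreducible` (`K = K̄`).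
* `PrimeDegreeClifford.mulVec_eq_zero_iff_exists_of_not_sq_dvd` (last section) — the GENERAL
  Lemma 6.2: for any `n` with `p ∣ n` (scalar commutant, `p² ∤ |H|`, `y ∈ H` of order `p`),
  `ker (y - 1) = im (y - 1)^{p-1}`, i.e. `Kⁿ` is free over `K⟨y⟩` ("`V` is projective"), by the
  same argument run on the HEIGHT of a vector of `ker N ∖ im N^{p-1}` with a local splitting
  endomorphism (`mul_localSplitting_comm`); `Subgroup.mulVec_eq_zero_iff_exists_of_isAbsIrreducible`
  (any field), `Subgroup.mulVec_eq_zero_iff_exists_of_isIrreducible` (`K = K̄`).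

Consequences for Theorem 1.7 (all classification-free):

* `Subgroup.cocycles₁_le_coboundaries₁_of_isAbsIrreducible_of_simple_le` /
  `…_of_isIrreducible_of_simple_le` — clause (ii) `H¹(H, ad/Z) = 0` for `p² ∤ |H|` as soon as `H`
  contains a simple non-commutative subgroup of order divisible by `p` (Cauchy + Lemma 6.2 +
  `Subgroup.cocycles₁_le_coboundaries₁_of_cyclicBasis_of_simple_le`): the freeness hypothesis of
  `H1VanishingCyclicSylow.lean` is DISCHARGED.
* `addMonoidHom_eq_zero_of_not_sq_dvd_of_simple_le` — clause (i) `Hom(H, k) = 0` under the same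
  hypotheses (a kernel of index `p` would be a normal `p`-complement).
* `Subgroup.addMonoidHom_eq_zero_and_cocycles₁_le_of_primitive_of_not_sq_dvd`,
  `Subgroup.isExtendedAdequate_iff_semisimpleSpan_eq_top_of_primitive_of_not_sq_dvd` — for a
  primitive irreducible `H ≤ GL_p(K̄)` with `p ∥ |H|` (its simple layer supplies `L`), clauses (i)
  and (ii) hold, so ADEQUATE ⇔ WEAKLY ADEQUATE.
* `ght2017_adequate_or_index_p_or_psl29_of_socle_odd_sq` — the residual hypothesis of the named
  fact split by `p² ∣ |G|`: for `p ∥ |G|` only WEAK ADEQUACY (clause (iii)) of the primitive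
  simple-socle groups is missing; for `p² ∣ |G|` the full "(a) or (c)".  What remains is still GHT
  Theorem 2.2 (which simple groups occur: CFSG) with the spanning/`Ext¹` results of Props. 6.7–6.14,
  Cor. 9.4–9.5.
* `addMonoidHom_eq_zero_and_cocycles₁_le_or_index_p_of_not_sq_dvd` (last section) — THEOREM 1.7
  FOR `p ∥ |G|`, CLAUSES (i) AND (ii): for `σ : G →* GL_p(k)` faithful absolutely irreducible over
  any field of characteristic `p` with `p² ∤ |G|`, `Hom(σ(G), k) = 0 ∧ H¹(σ(G), ad/Z) = 0` or `G`
  has an abelian normal subgroup of index `p`; and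
  `isExtendedAdequate_or_index_p_of_not_sq_dvd_of_semisimpleSpan`: Theorem 1.7 for `p ∥ |G|`
  granted weak adequacy.
* `Subgroup.not_isSolvable_of_primitive`, `isExtendedAdequate_or_index_p_of_isSolvable` (last
  section) — THEOREM 1.7 FOR SOLVABLE `G`, UNCONDITIONALLY (any `p`, any field of characteristic
  `p`): `σ(G)` adequate or `G` has an abelian normal subgroup of index `p`.
* `PrimeDegreeClifford.semisimpleSpan_eq_top_iff_forall_pow_mem` — for `K⟨H⟩ = M_p(K)`,
  `p ∥ |H|`, `y ∈ H` of order `p`: WEAK ADEQUACY ⇔ every `y^j` lies in the span of the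
  `p'`-elements (Jordan decomposition in `H`, Sylow conjugacy, commutant of a regular unipotent =
  `K[y]`, `p`-regular elements of `K[y]` are scalars); and the sharpest residual
  `ght2017_adequate_or_index_p_or_psl29_of_socle_odd_pow`.
* `not_alternativeC_of_not_sq_dvd`, `ght2017_disjunction_iff_of_not_sq_dvd` (last section) —
  alternative (c) forces `9 ∣ |G|`, so for `p ∥ |G|` the fact's disjunction is "(a) or (b)".

## References

* [GuralnickHerzigTiep2017] R. M. Guralnick, F. Herzig, P. H. Tiep, *Adequate subgroups and
  indecomposable modules*, J. Eur. Math. Soc. 19 (2017) 1231–1291 = arXiv:1405.0043, Lemma 6.2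
  (arXiv p. 19), Lemma 6.3, Proposition 6.5 (ii), proof of Theorem 6.15 (p. 24).
* [Thorne2017TwoAdic] J. Thorne, Math. Z. 285 (2017), Def. 2.20 (the notion of adequacy).
-/

open scoped MatrixGroups Matrix

namespace Literature.NumberTheory.GaloisRepresentations

universe u v

namespace PrimeDegreeClifford

variable {K : Type u} [Field K]

section RelativeTrace

variable {n : ℕ}

/-- **Relative trace (averaging over cosets).**  Let `H ≤ GL_n(K)` be finite with scalar
commutant (every matrix commuting with `H` is a scalar — Schur, e.g. `H` irreducible over
`K = K̄`), `n = 0` in `K`, and `Q ≤ H` of index invertible in `K`.  Then every matrix `θ`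
commuting with `Q` has trace `0`: the relative trace `T = Σ_{gQ ∈ H/Q} g θ g⁻¹` commutes with `H`,
so `T = c · 1` has trace `n c = 0`, while `tr T = [H : Q] · tr θ`. [folklore] -/
theorem trace_eq_zero_of_commute_of_index {H : Subgroup (GL (Fin n) K)} [Finite H]
    (hschur : ∀ M : Matrix (Fin n) (Fin n) K,
      (∀ h ∈ H, ((h : GL (Fin n) K) : Matrix (Fin n) (Fin n) K) * M = M * h) →
        ∃ c : K, M = c • (1 : Matrix (Fin n) (Fin n) K))
    (hn : (n : K) = 0) (Q : Subgroup H) (hQ : ((Q.index : ℕ) : K) ≠ 0)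
    {θ : Matrix (Fin n) (Fin n) K}
    (hθ : ∀ q : H, q ∈ Q →
      (((q : H) : GL (Fin n) K) : Matrix (Fin n) (Fin n) K) * θ =
        θ * (((q : H) : GL (Fin n) K) : Matrix (Fin n) (Fin n) K)) :
    Matrix.trace θ = 0 := by
  classical
  haveI : Fintype (H ⧸ Q) := Fintype.ofFinite _
  -- conjugation `g ↦ g θ g⁻¹`, constant on left cosets of `Q`
  set F : H → Matrix (Fin n) (Fin n) K := fun g =>
    ((g : GL (Fin n) K) : Matrix (Fin n) (Fin n) K) * θ *
      (((g : GL (Fin n) K)⁻¹ : GL (Fin n) K) : Matrix (Fin n) (Fin n) K) with hFdef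
  have hFmul : ∀ g h : H, F (g * h) =
      ((g : GL (Fin n) K) : Matrix (Fin n) (Fin n) K) * F h *
        (((g : GL (Fin n) K)⁻¹ : GL (Fin n) K) : Matrix (Fin n) (Fin n) K) := by
    intro g h
    simp only [hFdef, Subgroup.coe_mul, mul_inv_rev, Units.val_mul, Matrix.mul_assoc]
  have hFQ : ∀ q : H, q ∈ Q → F q = θ := by
    intro q hq
    simp only [hFdef]
    rw [hθ q hq, Matrix.mul_assoc, ← Units.val_mul, mul_inv_cancel, Units.val_one, Matrix.mul_one]
  have hcos : ∀ a b : H, (QuotientGroup.mk a : H ⧸ Q) = QuotientGroup.mk b → F a = F b := by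
    intro a b hab
    have hmem : a⁻¹ * b ∈ Q := QuotientGroup.eq.1 hab
    have e : b = a * (a⁻¹ * b) := by group
    rw [e, hFmul, hFQ _ hmem]
  set T : Matrix (Fin n) (Fin n) K := ∑ c : H ⧸ Q, F c.out with hTdef
  -- `T` commutes with `H`
  have hT : ∀ h ∈ H, ((h : GL (Fin n) K) : Matrix (Fin n) (Fin n) K) * T = T * h := by
    intro h hh
    set h' : H := ⟨h, hh⟩ with hh'
    have hconj : ((h' : GL (Fin n) K) : Matrix (Fin n) (Fin n) K) * T *
        (((h' : GL (Fin n) K)⁻¹ : GL (Fin n) K) : Matrix (Fin n) (Fin n) K) = T := by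
      have h1 : ∀ c : H ⧸ Q, ((h' : GL (Fin n) K) : Matrix (Fin n) (Fin n) K) * F c.out *
          (((h' : GL (Fin n) K)⁻¹ : GL (Fin n) K) : Matrix (Fin n) (Fin n) K) = F (h' • c).out := by
        intro c
        rw [← hFmul]
        apply hcos
        rw [QuotientGroup.out_eq']
        change (QuotientGroup.mk (h' • c.out) : H ⧸ Q) = h' • c
        rw [← MulAction.Quotient.smul_mk, QuotientGroup.out_eq']
      rw [hTdef, Finset.mul_sum, Finset.sum_mul, Finset.sum_congr rfl fun c _ => h1 c]
      exact Fintype.sum_equiv (MulAction.toPerm h') _ _ fun c => rfl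
    have hgg : (((h' : GL (Fin n) K)⁻¹ : GL (Fin n) K) : Matrix (Fin n) (Fin n) K) *
        ((h' : GL (Fin n) K) : Matrix (Fin n) (Fin n) K) = 1 := by
      rw [← Units.val_mul, inv_mul_cancel, Units.val_one]
    calc ((h : GL (Fin n) K) : Matrix (Fin n) (Fin n) K) * T
        = ((h' : GL (Fin n) K) : Matrix (Fin n) (Fin n) K) * T *
            ((((h' : GL (Fin n) K)⁻¹ : GL (Fin n) K) : Matrix (Fin n) (Fin n) K) *
              ((h' : GL (Fin n) K) : Matrix (Fin n) (Fin n) K)) := by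
          rw [hgg, Matrix.mul_one]
      _ = ((h' : GL (Fin n) K) : Matrix (Fin n) (Fin n) K) * T *
            (((h' : GL (Fin n) K)⁻¹ : GL (Fin n) K) : Matrix (Fin n) (Fin n) K) *
              ((h' : GL (Fin n) K) : Matrix (Fin n) (Fin n) K) := by
          simp only [Matrix.mul_assoc]
      _ = T * h := by rw [hconj]
  obtain ⟨c, hc⟩ := hschur T hT
  -- traces
  have htrT : Matrix.trace T = (Q.index : K) * Matrix.trace θ := by
    have h1 : ∀ g : H, Matrix.trace (F g) = Matrix.trace θ := by
      intro g
      simp only [hFdef]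
      rw [Matrix.trace_mul_cycle, ← Units.val_mul, inv_mul_cancel, Units.val_one, Matrix.one_mul]
    rw [hTdef, Matrix.trace_sum]
    simp_rw [h1]
    rw [Finset.sum_const, Finset.card_univ, nsmul_eq_mul, Subgroup.index, Nat.card_eq_fintype_card]
  have htrT' : Matrix.trace T = 0 := by
    rw [hc, Matrix.trace_smul, Matrix.trace_one, Fintype.card_fin, smul_eq_mul, hn, mul_zero]
  rw [htrT'] at htrT
  rcases mul_eq_zero.1 htrT.symm with h0 | h0
  · exact absurd h0 hQ
  · exact h0

end RelativeTrace

section JordanSplitting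

variable {n : ℕ}

/-- The splitting endomorphism of the top Jordan block: for `N ^ (m' + 1) = 0`, a column `C` and a
row `R`, the matrix `θ = Σ_{j ≤ m'} N^j C R N^{m'-j}` commutes with `N`. [folklore] -/
theorem mul_jordanSplitting_comm (N : Matrix (Fin n) (Fin n) K) (C : Matrix (Fin n) (Fin 1) K)
    (R : Matrix (Fin 1) (Fin n) K) (m' : ℕ) (hN : N ^ (m' + 1) = 0) :
    N * (∑ j ∈ Finset.range (m' + 1), N ^ j * C * R * N ^ (m' - j)) =
      (∑ j ∈ Finset.range (m' + 1), N ^ j * C * R * N ^ (m' - j)) * N := by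
  rw [Finset.mul_sum, Finset.sum_mul]
  have hl : ∀ j ∈ Finset.range (m' + 1), N * (N ^ j * C * R * N ^ (m' - j)) =
      N ^ (j + 1) * C * R * N ^ (m' - j) := by
    intro j _
    rw [pow_succ']
    simp only [Matrix.mul_assoc]
  have hr : ∀ j ∈ Finset.range (m' + 1), N ^ j * C * R * N ^ (m' - j) * N =
      N ^ j * C * R * N ^ (m' - j + 1) := by
    intro j _
    rw [pow_succ]
    simp only [Matrix.mul_assoc]
  rw [Finset.sum_congr rfl hl, Finset.sum_congr rfl hr, Finset.sum_range_succ,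
    Finset.sum_range_succ' (fun j => N ^ j * C * R * N ^ (m' - j + 1))]
  rw [hN, Matrix.zero_mul, Matrix.zero_mul, Matrix.zero_mul, add_zero, Nat.sub_zero, pow_zero, hN,
    Matrix.mul_zero, add_zero]
  refine Finset.sum_congr rfl fun j hj => ?_
  rw [Finset.mem_range] at hj
  have e : m' - (j + 1) + 1 = m' - j := by omega
  rw [e]

/-- The trace of the splitting endomorphism is `(m' + 1) · tr (R N^{m'} C)`. [folklore] -/
theorem trace_jordanSplitting (N : Matrix (Fin n) (Fin n) K) (C : Matrix (Fin n) (Fin 1) K)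
    (R : Matrix (Fin 1) (Fin n) K) (m' : ℕ) :
    Matrix.trace (∑ j ∈ Finset.range (m' + 1), N ^ j * C * R * N ^ (m' - j)) =
      ((m' + 1 : ℕ) : K) * Matrix.trace (R * N ^ m' * C) := by
  rw [Matrix.trace_sum]
  have h : ∀ j ∈ Finset.range (m' + 1), Matrix.trace (N ^ j * C * R * N ^ (m' - j)) =
      Matrix.trace (R * N ^ m' * C) := by
    intro j hj
    rw [Finset.mem_range] at hj
    have e1 : N ^ j * C * R * N ^ (m' - j) = (N ^ j * C) * (R * N ^ (m' - j)) := by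
      simp only [Matrix.mul_assoc]
    rw [e1, Matrix.trace_mul_comm]
    have e2 : R * N ^ (m' - j) * (N ^ j * C) = R * N ^ m' * C := by
      rw [show R * N ^ m' * C = R * (N ^ (m' - j) * N ^ j) * C by
        rw [← pow_add, Nat.sub_add_cancel (by omega)]]
      simp only [Matrix.mul_assoc]
    rw [e2]
  rw [Finset.sum_congr rfl h, Finset.sum_const, Finset.card_range, nsmul_eq_mul]

/-- The `1 × 1` matrix `R X C` for the coordinate row `R = e_a` and column `C = e_b` has trace
`X a b`. [folklore] -/
theorem trace_row_mul_mul_col (X : Matrix (Fin n) (Fin n) K) (a b : Fin n) :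
    Matrix.trace (Matrix.replicateRow (Fin 1) (Pi.single a (1 : K)) * X *
      Matrix.replicateCol (Fin 1) (Pi.single b (1 : K))) = X a b := by
  classical
  rw [Matrix.trace_fin_one, Matrix.mul_apply]
  simp only [Matrix.replicateCol_apply, Matrix.mul_apply, Matrix.replicateRow_apply]
  simp only [Pi.single_apply, ite_mul, one_mul, zero_mul, Finset.mem_univ, if_true, mul_ite,
    mul_one, mul_zero, Finset.sum_ite_eq', if_true]

/-- A non-zero matrix has a non-zero entry. [folklore] -/
theorem exists_apply_ne_zero_of_ne_zero {X : Matrix (Fin n) (Fin n) K} (hX : X ≠ 0) :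
    ∃ a b, X a b ≠ 0 := by
  by_contra hcon
  push Not at hcon
  exact hX (Matrix.ext fun a b => by rw [hcon a b, Matrix.zero_apply])

end JordanSplitting

section CyclicVector

variable {n : ℕ}

/-- **Iterates of a nilpotent matrix on a vector of maximal height are linearly independent.**
If `N ^ n = 0` on `Kⁿ` and `N^{n-1} v ≠ 0` then `v, N v, …, N^{n-1} v` are linearly independent.
[folklore] -/
theorem linearIndependent_pow_mulVec (N : Matrix (Fin n) (Fin n) K) (v : Fin n → K)
    (hNn : N ^ n = 0) (hv : N ^ (n - 1) *ᵥ v ≠ 0) :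
    LinearIndependent K fun i : Fin n => N ^ (i : ℕ) *ᵥ v := by
  classical
  rw [Fintype.linearIndependent_iff]
  intro g hg
  suffices h : ∀ i : ℕ, ∀ hi : i < n, g ⟨i, hi⟩ = 0 from fun i => h i i.2
  intro i
  induction i using Nat.strong_induction_on with
  | _ i ih =>
    intro hi
    have h1 := congrArg (fun w => N ^ (n - 1 - i) *ᵥ w) hg
    simp only [Matrix.mulVec_sum, Matrix.mulVec_smul, Matrix.mulVec_mulVec, ← pow_add,
      Matrix.mulVec_zero] at h1
    rw [Finset.sum_eq_single ⟨i, hi⟩] at h1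
    · have e : n - 1 - i + i = n - 1 := by omega
      rw [e] at h1
      rcases smul_eq_zero.1 h1 with h | h
      · exact h
      · exact absurd h hv
    · intro j _ hji
      rcases lt_or_gt_of_ne (fun h : (j : ℕ) = i => hji (Fin.ext h)) with hlt | hgt
      · rw [ih j hlt j.2, zero_smul]
      · have e : n - 1 - i + (j : ℕ) = n + (j - 1 - i) := by omega
        rw [e, pow_add, hNn, Matrix.zero_mul, Matrix.zero_mulVec, smul_zero]
    · intro h; exact absurd (Finset.mem_univ _) h

/-- For a matrix `Y` with `Y ^ m = 1` (`0 < m`), the span of the `Y^j v`, `j < m`, is `Y`-stable,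
hence contains every `(Y - 1)^i v`. [folklore] -/
theorem pow_sub_one_mulVec_mem_span (Y : Matrix (Fin n) (Fin n) K) (v : Fin n → K) {m : ℕ}
    (hm : 0 < m) (hY : Y ^ m = 1) (i : ℕ) :
    (Y - 1) ^ i *ᵥ v ∈ Submodule.span K (Set.range fun j : Fin m => Y ^ (j : ℕ) *ᵥ v) := by
  classical
  set W := Submodule.span K (Set.range fun j : Fin m => Y ^ (j : ℕ) *ᵥ v) with hW
  -- `W` is `Y`-stable
  have hstab : ∀ w ∈ W, Y *ᵥ w ∈ W := by
    intro w hw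
    have hmap : W.map (Matrix.toLin' Y) ≤ W := by
      rw [hW, Submodule.map_span, Submodule.span_le]
      rintro _ ⟨_, ⟨j, rfl⟩, rfl⟩
      rw [Matrix.toLin'_apply, Matrix.mulVec_mulVec, ← pow_succ']
      by_cases hj : (j : ℕ) + 1 < m
      · exact Submodule.subset_span ⟨⟨(j : ℕ) + 1, hj⟩, rfl⟩
      · have e : (j : ℕ) + 1 = m := by omega
        rw [e, hY, ← pow_zero Y]
        exact Submodule.subset_span ⟨⟨0, hm⟩, rfl⟩
    exact hmap ⟨w, hw, rfl⟩
  induction i with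
  | zero =>
    rw [pow_zero, Matrix.one_mulVec]
    exact Submodule.subset_span ⟨⟨0, hm⟩, by simp⟩
  | succ i ih =>
    rw [pow_succ', ← Matrix.mulVec_mulVec, Matrix.sub_mulVec, Matrix.one_mulVec]
    exact W.sub_mem (hstab _ ih) ih

/-- **A cyclic vector for `Y - 1` is a cyclic vector for `Y`.**  If `Y ^ n = 1` on `Kⁿ` (`0 < n`),
`(Y - 1)^n = 0` and `(Y - 1)^{n-1} v ≠ 0`, then `v, Y v, …, Y^{n-1} v` are linearly independent.
[folklore] -/
theorem linearIndependent_pow_mulVec_of_sub_one (Y : Matrix (Fin n) (Fin n) K) (v : Fin n → K)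
    (hn : 0 < n) (hY : Y ^ n = 1) (hNn : (Y - 1) ^ n = 0) (hv : (Y - 1) ^ (n - 1) *ᵥ v ≠ 0) :
    LinearIndependent K fun i : Fin n => Y ^ (i : ℕ) *ᵥ v := by
  have hli := linearIndependent_pow_mulVec (Y - 1) v hNn hv
  rw [linearIndependent_iff_card_eq_finrank_span, Fintype.card_fin]
  apply le_antisymm
  · -- `p ≤ finrank (span (Y^i v))`: it contains the span of the `N^i v`
    have hle : Submodule.span K (Set.range fun i : Fin n => (Y - 1) ^ (i : ℕ) *ᵥ v) ≤
        Submodule.span K (Set.range fun j : Fin n => Y ^ (j : ℕ) *ᵥ v) := by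
      rw [Submodule.span_le]
      rintro _ ⟨i, rfl⟩
      exact pow_sub_one_mulVec_mem_span Y v hn hY i
    have h1 := Submodule.finrank_mono hle
    rw [finrank_span_eq_card hli, Fintype.card_fin] at h1
    exact h1
  · have h2 := Submodule.finrank_le (Submodule.span K (Set.range fun j : Fin n => Y ^ (j : ℕ) *ᵥ v))
    rw [Module.finrank_fin_fun] at h2
    exact h2

end CyclicVector

section LemmaSixTwo

variable {p : ℕ} [Fact p.Prime] [CharP K p]

/-- **GHT Lemma 6.2 in degree `p`, classification- and Green-correspondence-free.**  Let
`H ≤ GL_p(K)` be finite with scalar commutant (`char K = p`), `p² ∤ |H|`, and `y ∈ H` of order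
`p`.  Then `y` is a single Jordan block: `Kᵖ` is free of rank one over `K⟨y⟩`, i.e. `y` permutes a
basis cyclically.  (If `(y-1)^{p-1} = 0`, let `m < p` be the nilpotency index of `N = y - 1`; the
splitting endomorphism `θ = Σ_{j<m} N^j C R N^{m-1-j}` of a top Jordan block commutes with `y` and
has trace `m · (R N^{m-1} C) ≠ 0`, contradicting `trace_eq_zero_of_commute_of_index` for
`Q = ⟨y⟩`, of index `|H|/p` prime to `p`.)  GHT: "Let `G` be a finite group with a Sylow
`p`-subgroup `P` of order `p` and let `V ∈ IBr_p(G)` be such that `p ∣ dim V`. Then `V` is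
projective" — for `dim V = p`, projective = free over `kP` = one Jordan block.
[cite: GuralnickHerzigTiep2017, Lemma 6.2] -/
theorem exists_cyclicBasis_of_not_sq_dvd {H : Subgroup (GL (Fin p) K)} [Finite H]
    (hschur : ∀ M : Matrix (Fin p) (Fin p) K,
      (∀ h ∈ H, ((h : GL (Fin p) K) : Matrix (Fin p) (Fin p) K) * M = M * h) →
        ∃ c : K, M = c • (1 : Matrix (Fin p) (Fin p) K))
    (hp2 : ¬p ^ 2 ∣ Nat.card H) (y : H) (hy : orderOf y = p) :
    ∃ e : Module.Basis (ZMod p) K (Fin p → K),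
      ∀ w, (((y : H) : GL (Fin p) K) : Matrix (Fin p) (Fin p) K) *ᵥ e w = e (w + 1) := by
  classical
  have hp : p.Prime := Fact.out
  haveI : Nonempty (Fin p) := ⟨⟨0, hp.pos⟩⟩
  set Y : Matrix (Fin p) (Fin p) K := (((y : H) : GL (Fin p) K) : Matrix (Fin p) (Fin p) K) with hYdef
  -- the index of `Q = ⟨y⟩` is invertible in `K`
  set Q : Subgroup H := Subgroup.zpowers y with hQdef
  have hQcard : Nat.card Q = p := by rw [hQdef, Nat.card_zpowers, hy]
  have hQidx : ((Q.index : ℕ) : K) ≠ 0 := by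
    intro h0
    rw [CharP.cast_eq_zero_iff K p] at h0
    apply hp2
    rw [← Subgroup.card_mul_index Q, hQcard, pow_two]
    exact Nat.mul_dvd_mul_left p h0
  -- every matrix commuting with `N = Y - 1` has trace zero
  have htr : ∀ θ : Matrix (Fin p) (Fin p) K, (Y - 1) * θ = θ * (Y - 1) → Matrix.trace θ = 0 := by
    intro θ hθ
    have hYθ : Commute Y θ := by
      have e : Y = (Y - 1) + 1 := by abel
      have h1 : Commute (Y - 1) θ := hθ
      rw [e]
      exact h1.add_left (Commute.one_left θ)
    refine trace_eq_zero_of_commute_of_index hschur (CharP.cast_eq_zero K p) Q hQidx ?_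
    intro q hq
    rw [hQdef] at hq
    obtain ⟨k, rfl⟩ := Subgroup.mem_zpowers_iff.1 hq
    have h2 := hYθ.units_zpow_left k
    rw [Subgroup.coe_zpow]
    exact h2
  -- `N ^ p = 0`
  have hyp : y ^ p = 1 := orderOf_dvd_iff_pow_eq_one.1 (by rw [hy])
  have hYp : Y ^ p = 1 := by
    rw [hYdef, ← Units.val_pow_eq_pow_val, ← Subgroup.coe_pow, hyp, Subgroup.coe_one, Units.val_one]
  have hNp : (Y - 1) ^ p = 0 := by
    rw [sub_pow_char_of_commute p (Commute.one_right Y), one_pow, hYp, sub_self]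
  -- `N ^ (p - 1) ≠ 0`
  have hN1 : (Y - 1) ^ (p - 1) ≠ 0 := by
    intro h0
    have hex : ∃ m, (Y - 1) ^ m = 0 := ⟨p - 1, h0⟩
    have hm0 : (Y - 1) ^ Nat.find hex = 0 := Nat.find_spec hex
    have hmle : Nat.find hex ≤ p - 1 := Nat.find_min' hex h0
    have hmpos : Nat.find hex ≠ 0 := by
      intro hz
      rw [hz, pow_zero] at hm0
      exact one_ne_zero hm0
    obtain ⟨m', hm'⟩ := Nat.exists_eq_succ_of_ne_zero hmpos
    have hm'ne : (Y - 1) ^ m' ≠ 0 := Nat.find_min hex (by omega)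
    rw [hm'] at hm0
    obtain ⟨a, b, hab⟩ := exists_apply_ne_zero_of_ne_zero hm'ne
    set C : Matrix (Fin p) (Fin 1) K := Matrix.replicateCol (Fin 1) (Pi.single b (1 : K)) with hC
    set R : Matrix (Fin 1) (Fin p) K := Matrix.replicateRow (Fin 1) (Pi.single a (1 : K)) with hR
    have h1 := htr _ (mul_jordanSplitting_comm (Y - 1) C R m' hm0)
    rw [trace_jordanSplitting, hR, hC, trace_row_mul_mul_col] at h1
    have hcast : ((m' + 1 : ℕ) : K) ≠ 0 := by
      rw [Ne, CharP.cast_eq_zero_iff K p]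
      intro hd
      have := Nat.le_of_dvd (Nat.succ_pos m') hd
      omega
    rcases mul_eq_zero.1 h1 with h | h
    · exact hcast h
    · exact hab h
  -- a cyclic vector
  obtain ⟨a, b, hab⟩ := exists_apply_ne_zero_of_ne_zero hN1
  set v : Fin p → K := Pi.single b (1 : K) with hv
  have hvne : (Y - 1) ^ (p - 1) *ᵥ v ≠ 0 := by
    intro h0
    apply hab
    have h1 := congrFun h0 a
    rw [hv, Matrix.mulVec_single_one] at h1
    exact h1
  have hli := linearIndependent_pow_mulVec_of_sub_one Y v hp.pos hYp hNp hvne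
  have hyG : orderOf ((y : H) : GL (Fin p) K) = p := by rw [Subgroup.orderOf_coe, hy]
  refine exists_cyclicBasis_of_linearIndependent ((y : H) : GL (Fin p) K) hyG v ?_
  simpa only [Units.val_pow_eq_pow_val] using hli

end LemmaSixTwo

section SchurFromSpan

variable {n : ℕ}

/-- **Schur from Burnside spanning, any field.**  If the matrices of `H ≤ GL_n(K)` span `M_n(K)`
(i.e. `H` is absolutely irreducible), a matrix commuting with `H` commutes with everything, so is
a scalar. [folklore] -/
theorem exists_eq_smul_one_of_span_eq_top {H : Subgroup (GL (Fin n) K)}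
    (hspan : Submodule.span K
      (Set.range fun h : H => ((h : GL (Fin n) K) : Matrix (Fin n) (Fin n) K)) = ⊤)
    {M : Matrix (Fin n) (Fin n) K}
    (hM : ∀ h ∈ H, ((h : GL (Fin n) K) : Matrix (Fin n) (Fin n) K) * M = M * h) :
    ∃ c : K, M = c • (1 : Matrix (Fin n) (Fin n) K) := by
  have hall : ∀ X : Matrix (Fin n) (Fin n) K, X * M = M * X := by
    intro X
    have hX : X ∈ Submodule.span K
        (Set.range fun h : H => ((h : GL (Fin n) K) : Matrix (Fin n) (Fin n) K)) :=
      hspan ▸ Submodule.mem_top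
    refine Submodule.span_induction (p := fun X _ => X * M = M * X) ?_ ?_ ?_ ?_ hX
    · rintro _ ⟨h, rfl⟩
      exact hM h h.2
    · rw [Matrix.zero_mul, Matrix.mul_zero]
    · intro X Y _ _ hX hY
      rw [add_mul, mul_add, hX, hY]
    · intro c X _ hX
      rw [smul_mul_assoc, mul_smul_comm, hX]
  have hmem : M ∈ Set.center (Matrix (Fin n) (Fin n) K) :=
    Semigroup.mem_center_iff.2 fun X => hall X
  rw [Matrix.center_eq_range] at hmem
  obtain ⟨c, hc⟩ := hmem
  refine ⟨c, ?_⟩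
  rw [← hc, Matrix.scalar_apply, Matrix.smul_one_eq_diagonal]

/-- The matrices of an absolutely irreducible `H ≤ GL_n(k)` span `M_n(k)` (Burnside over `k̄`,
descended; `Literature.RepresentationTheory.Semisimple.span_eq_top_iff_forall_isIrreducible`).
[folklore] -/
theorem span_eq_top_of_isAbsIrreducible {H : Subgroup (GL (Fin n) K)}
    (hirr : IsAbsIrreducible H.subtype) :
    Submodule.span K
      (Set.range fun h : H => ((h : GL (Fin n) K) : Matrix (Fin n) (Fin n) K)) = ⊤ :=
  (Literature.RepresentationTheory.Semisimple.span_eq_top_iff_forall_isIrreducible hirr.pos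
    H.subtype).2 hirr

end SchurFromSpan

end PrimeDegreeClifford

/-! ## Consequences: Lemma 6.2 in degree `p`; clauses (i), (ii) for `p ∥ |H|` -/

section LemmaSixTwoConsequences

variable {p : ℕ} [Fact p.Prime]

/-- **GHT Lemma 6.2 in degree `p` (any field): a `p`-element of an absolutely irreducible
`H ≤ GL_p(k)` with `p² ∤ |H|` permutes a basis cyclically** (`kᵖ` is free over `k⟨y⟩`: "`V` is
projective"). [cite: GuralnickHerzigTiep2017, Lemma 6.2] -/
theorem Subgroup.exists_cyclicBasis_of_isAbsIrreducible {k : Type u} [Field k] [CharP k p]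
    {H : Subgroup (GL (Fin p) k)} [Finite H] (hirr : IsAbsIrreducible H.subtype)
    (hp2 : ¬p ^ 2 ∣ Nat.card H) (y : H) (hy : orderOf y = p) :
    ∃ e : Module.Basis (ZMod p) k (Fin p → k),
      ∀ w, (((y : H) : GL (Fin p) k) : Matrix (Fin p) (Fin p) k) *ᵥ e w = e (w + 1) :=
  PrimeDegreeClifford.exists_cyclicBasis_of_not_sq_dvd
    (fun _ hM => PrimeDegreeClifford.exists_eq_smul_one_of_span_eq_top
      (PrimeDegreeClifford.span_eq_top_of_isAbsIrreducible hirr) hM) hp2 y hy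

/-- **GHT Lemma 6.2 in degree `p` (`K = K̄`): a `p`-element of an irreducible `H ≤ GL_p(K)` with
`p² ∤ |H|` permutes a basis cyclically.** [cite: GuralnickHerzigTiep2017, Lemma 6.2] -/
theorem Subgroup.exists_cyclicBasis_of_isIrreducible {K : Type u} [Field K] [IsAlgClosed K]
    [CharP K p] {H : Subgroup (GL (Fin p) K)} [Finite H]
    (hirr : (glRepresentation H.subtype).IsIrreducible)
    (hp2 : ¬p ^ 2 ∣ Nat.card H) (y : H) (hy : orderOf y = p) :
    ∃ e : Module.Basis (ZMod p) K (Fin p → K),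
      ∀ w, (((y : H) : GL (Fin p) K) : Matrix (Fin p) (Fin p) K) *ᵥ e w = e (w + 1) :=
  PrimeDegreeClifford.exists_cyclicBasis_of_not_sq_dvd
    (fun _ hM => PrimeDegreeClifford.exists_eq_smul_one_of_forall_commute hirr hM) hp2 y hy

/-- **Clause (ii) for `p ∥ |H|`, any field** (GHT Lemmas 6.2 + 6.3, classification-free): if the
finite absolutely irreducible `H ≤ GL_p(k)` (`char k = p`, `p² ∤ |H|`) contains a simple
non-commutative subgroup `L` of order divisible by `p`, then `H¹(H, ad/Z) = 0`.  (Cauchy gives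
`y ∈ L` of order `p`; it acts freely by Lemma 6.2; then
`Subgroup.cocycles₁_le_coboundaries₁_of_cyclicBasis_of_simple_le`.)
[cite: GuralnickHerzigTiep2017, Lemmas 6.2–6.3 and proof of Theorem 6.15 (p. 24)] -/
theorem Subgroup.cocycles₁_le_coboundaries₁_of_isAbsIrreducible_of_simple_le {k : Type u} [Field k]
    [CharP k p] (H : Subgroup (GL (Fin p) k)) [Finite H] (hirr : IsAbsIrreducible H.subtype)
    (hp2 : ¬p ^ 2 ∣ Nat.card H) {L : Subgroup H} (hsimple : IsSimpleGroup L)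
    (hcomm : ¬∀ a b : L, a * b = b * a) (hdiv : p ∣ Nat.card L) :
    groupCohomology.cocycles₁ (Rep.of (Subgroup.adModScalarRep H)) ≤
      groupCohomology.coboundaries₁ (Rep.of (Subgroup.adModScalarRep H)) := by
  obtain ⟨x, hx⟩ := exists_prime_orderOf_dvd_card' p hdiv
  have hy : orderOf (x : H) = p := by rw [Subgroup.orderOf_coe, hx]
  obtain ⟨e, he⟩ := Subgroup.exists_cyclicBasis_of_isAbsIrreducible hirr hp2 (x : H) hy
  exact Subgroup.cocycles₁_le_coboundaries₁_of_cyclicBasis_of_simple_le H (x : H) hy hp2 e he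
    hsimple hcomm hdiv

/-- **Clause (ii) for `p ∥ |H|`, `K = K̄`**: a finite irreducible `H ≤ GL_p(K)` (`char K = p`,
`p² ∤ |H|`) containing a simple non-commutative subgroup of order divisible by `p` has
`H¹(H, ad/Z) = 0`. [cite: GuralnickHerzigTiep2017, Lemmas 6.2–6.3 and proof of Theorem 6.15] -/
theorem Subgroup.cocycles₁_le_coboundaries₁_of_isIrreducible_of_simple_le {K : Type u} [Field K]
    [IsAlgClosed K] [CharP K p] (H : Subgroup (GL (Fin p) K)) [Finite H]
    (hirr : (glRepresentation H.subtype).IsIrreducible)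
    (hp2 : ¬p ^ 2 ∣ Nat.card H) {L : Subgroup H} (hsimple : IsSimpleGroup L)
    (hcomm : ¬∀ a b : L, a * b = b * a) (hdiv : p ∣ Nat.card L) :
    groupCohomology.cocycles₁ (Rep.of (Subgroup.adModScalarRep H)) ≤
      groupCohomology.coboundaries₁ (Rep.of (Subgroup.adModScalarRep H)) := by
  obtain ⟨x, hx⟩ := exists_prime_orderOf_dvd_card' p hdiv
  have hy : orderOf (x : H) = p := by rw [Subgroup.orderOf_coe, hx]
  obtain ⟨e, he⟩ := Subgroup.exists_cyclicBasis_of_isIrreducible hirr hp2 (x : H) hy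
  exact Subgroup.cocycles₁_le_coboundaries₁_of_cyclicBasis_of_simple_le H (x : H) hy hp2 e he
    hsimple hcomm hdiv

/-- **Clause (i) for `p ∥ |H|`** (group theory): if `p² ∤ |H|` and `H` contains a simple
non-commutative subgroup `L` with `p ∣ |L|`, then `Hom(H, k) = 0` for `k` of characteristic `p`:
a non-zero additive character has kernel of index `p` and `p'`-order — a normal `p`-complement,
excluded by `index_ne_of_simple_le`. [cite: GuralnickHerzigTiep2017, Lemma 6.3 and proof of
Theorem 6.15 (p. 24)] -/
theorem addMonoidHom_eq_zero_of_not_sq_dvd_of_simple_le {k : Type u} [Field k] [CharP k p]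
    {H : Type*} [Group H] [Finite H] (hp2 : ¬p ^ 2 ∣ Nat.card H) {L : Subgroup H}
    (hsimple : IsSimpleGroup L) (hcomm : ¬∀ a b : L, a * b = b * a) (hdiv : p ∣ Nat.card L)
    (F : Additive H →+ k) : F = 0 := by
  classical
  by_contra hF
  let φ : H →* Multiplicative k := AddMonoidHom.toMultiplicative F
  have hφ : ∀ h : H, φ h = Multiplicative.ofAdd (F (Additive.ofMul h)) := fun h => rfl
  haveI : Finite φ.range := Finite.of_surjective _ (MonoidHom.rangeRestrict_surjective φ)
  have hpg : IsPGroup p φ.range := by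
    intro g
    refine ⟨1, ?_⟩
    obtain ⟨h, hh⟩ := g.2
    apply Subtype.ext
    rw [pow_one, SubmonoidClass.coe_pow, OneMemClass.coe_one, ← hh, hφ, ← ofAdd_nsmul, nsmul_eq_mul,
      CharP.cast_eq_zero, zero_mul, ofAdd_zero]
  obtain ⟨n, hn⟩ := IsPGroup.iff_card.1 hpg
  have hidx : φ.ker.index = p ^ n := by rw [Subgroup.index_ker, hn]
  have hn2 : n < 2 := by
    by_contra hge
    apply hp2
    have h := Subgroup.index_dvd_card φ.ker
    rw [hidx] at h
    exact (pow_dvd_pow p (not_lt.1 hge)).trans h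
  interval_cases n
  · have htop : φ.ker = ⊤ := Subgroup.index_eq_one.1 (by rw [hidx, pow_zero])
    refine hF (AddMonoidHom.ext fun x => ?_)
    have hx' : φ (Additive.toMul x) = 1 := by
      rw [← MonoidHom.mem_ker, htop]; exact Subgroup.mem_top _
    rw [hφ, ofMul_toMul, ofAdd_eq_one] at hx'
    rw [hx', AddMonoidHom.zero_apply]
  · rw [pow_one] at hidx
    refine index_ne_of_simple_le hsimple hcomm hdiv φ.ker ?_ hidx
    intro hdvd
    apply hp2
    rw [← Subgroup.card_mul_index φ.ker, hidx, pow_two]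
    exact Nat.mul_dvd_mul_right hdvd p

/-- **Clauses (i) and (ii) in the primitive case with `p ∥ |H|`, classification-free.**  For
`K = K̄` of characteristic `p` and a finite irreducible `H ≤ GL_p(K)` all of whose
line-permutation structures have central kernel (primitive; GHT Prop. 6.5 (ii)) with `p² ∤ |H|`:
`Hom(H, K) = 0` and `H¹(H, ad/Z) = 0`.  (The simple layer `L` — irreducible, so non-commutative,
of order divisible by `p`, `Subgroup.exists_simple_normal_dvd_card_of_primitive` — feeds the two
theorems above.)  So for `p ∥ |H|` adequacy of a primitive group of degree `p` is equivalent to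
weak adequacy (clause (iii)). [cite: GuralnickHerzigTiep2017, Lemmas 6.2–6.3, Proposition 6.5 (ii),
proof of Theorem 6.15 (p. 24)] -/
theorem Subgroup.addMonoidHom_eq_zero_and_cocycles₁_le_of_primitive_of_not_sq_dvd {K : Type u}
    [Field K] [IsAlgClosed K] [CharP K p] {H : Subgroup (GL (Fin p) K)} [Finite H]
    (hirrH : (glRepresentation H.subtype).IsIrreducible)
    (hmono : ∀ (b : Module.Basis (Fin p) K (Fin p → K)) (θ : ↥H →* Equiv.Perm (Fin p)),
      (∀ (h : H) (i : Fin p), ∃ c : K,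
        ((h : GL (Fin p) K) : Matrix (Fin p) (Fin p) K) *ᵥ b i = c • b (θ h i)) →
      θ.ker ≤ Subgroup.center H)
    (hp2 : ¬p ^ 2 ∣ Nat.card H) :
    (∀ f : Additive H →+ K, f = 0) ∧
      groupCohomology.cocycles₁ (Rep.of (Subgroup.adModScalarRep H)) ≤
        groupCohomology.coboundaries₁ (Rep.of (Subgroup.adModScalarRep H)) := by
  obtain ⟨L, hLH, -, hirrL, -, hsimple, hdvd, -, -⟩ :=
    Subgroup.exists_simple_normal_dvd_card_of_primitive hirrH hmono
  haveI : IsSimpleGroup L := hsimple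
  set L' : Subgroup H := L.subgroupOf H with hL'
  have e : L' ≃* L := Subgroup.subgroupOfEquivOfLe hLH
  have hsimple' : IsSimpleGroup L' := e.isSimpleGroup
  have hcomm' : ¬∀ a b : L', a * b = b * a := by
    intro hc
    refine PrimeDegreeClifford.not_isIrreducible_of_comm (A := L) ?_ hirrL
    intro x hx y hy
    have h1 := hc ⟨⟨x, hLH hx⟩, Subgroup.mem_subgroupOf.2 hx⟩ ⟨⟨y, hLH hy⟩, Subgroup.mem_subgroupOf.2 hy⟩
    have h2 := congrArg (fun z : L' => (((z : H) : GL (Fin p) K))) h1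
    simpa using h2
  have hdvd' : p ∣ Nat.card L' := by rwa [Nat.card_congr e.toEquiv]
  exact ⟨addMonoidHom_eq_zero_of_not_sq_dvd_of_simple_le hp2 hsimple' hcomm' hdvd',
    Subgroup.cocycles₁_le_coboundaries₁_of_isIrreducible_of_simple_le H hirrH hp2 hsimple' hcomm'
      hdvd'⟩

/-- **For `p ∥ |H|`, a primitive group of degree `p` is adequate iff it is weakly adequate.**
[cite: GuralnickHerzigTiep2017, Lemmas 6.2–6.3, proof of Theorem 6.15 (p. 24)] -/
theorem Subgroup.isExtendedAdequate_iff_semisimpleSpan_eq_top_of_primitive_of_not_sq_dvd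
    {K : Type u} [Field K] [IsAlgClosed K] [CharP K p] {H : Subgroup (GL (Fin p) K)} [Finite H]
    (hirrH : (glRepresentation H.subtype).IsIrreducible)
    (hmono : ∀ (b : Module.Basis (Fin p) K (Fin p → K)) (θ : ↥H →* Equiv.Perm (Fin p)),
      (∀ (h : H) (i : Fin p), ∃ c : K,
        ((h : GL (Fin p) K) : Matrix (Fin p) (Fin p) K) *ᵥ b i = c • b (θ h i)) →
      θ.ker ≤ Subgroup.center H)
    (hp2 : ¬p ^ 2 ∣ Nat.card H) :
    Subgroup.IsExtendedAdequate H ↔ Subgroup.semisimpleSpan H = ⊤ := by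
  refine ⟨fun h => h.semisimpleSpan_eq_top, fun h => ?_⟩
  obtain ⟨h1, h2⟩ :=
    Subgroup.addMonoidHom_eq_zero_and_cocycles₁_le_of_primitive_of_not_sq_dvd hirrH hmono hp2
  exact ⟨h1, h2, h⟩

/-- **The residual hypothesis of Theorem 1.7, split by `p² ∣ |G|`.**  The named fact follows from:
(1) WEAK ADEQUACY (clause (iii): `M_p(K)` is spanned by the `p'`-elements) of the primitive `τ(G)`
with its simple socle-layer `L`, when `p² ∤ |G|` — clauses (i), (ii) being settled by
`Subgroup.addMonoidHom_eq_zero_and_cocycles₁_le_of_primitive_of_not_sq_dvd` (GHT Lemmas 6.2–6.3,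
here classification-free); and (2) "(a) or (`p = 3`, `L ≅ A₆`, `τ(G) ≤ L · Z`)" when `p² ∣ |G|`.
Both remain inputs of GHT Theorem 2.2 (CFSG) with Props. 6.7–6.14, Cor. 9.4–9.5; NOT in the tree.
[cite: GuralnickHerzigTiep2017, Theorem 6.15 (proof, p. 24), Lemmas 6.2–6.3, Theorem 2.2] -/
theorem ght2017_adequate_or_index_p_or_psl29_of_socle_odd_sq
    (hw : ∀ (p : ℕ) [Fact p.Prime] (K : Type u) [Field K] [IsAlgClosed K] [CharP K p]
      (G : Type v) [Group G] [Finite G] (τ : G →* GL (Fin p) K),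
      p ≠ 2 → Function.Injective τ → (glRepresentation τ).IsIrreducible →
      (∀ (b : Module.Basis (Fin p) K (Fin p → K)) (θ : ↥τ.range →* Equiv.Perm (Fin p)),
        (∀ (h : τ.range) (i : Fin p), ∃ c : K,
          ((h : GL (Fin p) K) : Matrix (Fin p) (Fin p) K) *ᵥ b i = c • b (θ h i)) →
        θ.ker ≤ Subgroup.center τ.range) →
      ∀ L : Subgroup (GL (Fin p) K), L ≤ τ.range → (∀ h ∈ τ.range, ∀ x ∈ L, h * x * h⁻¹ ∈ L) →
        (∀ N : Subgroup (GL (Fin p) K), N ≤ τ.range → (∀ h ∈ τ.range, ∀ x ∈ N, h * x * h⁻¹ ∈ N) →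
          (∀ x ∈ N, ∃ c : K, ((x : GL (Fin p) K) : Matrix (Fin p) (Fin p) K) = c • 1) ∨ L ≤ N) →
        (∀ g ∈ τ.range, (∀ x ∈ L, g * x * g⁻¹ = x) →
          ∃ c : K, ((g : GL (Fin p) K) : Matrix (Fin p) (Fin p) K) = c • 1) →
        (glRepresentation L.subtype).IsIrreducible →
        (∀ x ∈ L, Matrix.det ((x : GL (Fin p) K) : Matrix (Fin p) (Fin p) K) = 1) →
        IsSimpleGroup L → p ∣ Nat.card L → ¬p ^ 2 ∣ Nat.card G →
        Subgroup.semisimpleSpan τ.range = ⊤)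
    (hs : ∀ (p : ℕ) [Fact p.Prime] (K : Type u) [Field K] [IsAlgClosed K] [CharP K p]
      (G : Type v) [Group G] [Finite G] (τ : G →* GL (Fin p) K),
      p ≠ 2 → Function.Injective τ → (glRepresentation τ).IsIrreducible →
      (∀ (b : Module.Basis (Fin p) K (Fin p → K)) (θ : ↥τ.range →* Equiv.Perm (Fin p)),
        (∀ (h : τ.range) (i : Fin p), ∃ c : K,
          ((h : GL (Fin p) K) : Matrix (Fin p) (Fin p) K) *ᵥ b i = c • b (θ h i)) →
        θ.ker ≤ Subgroup.center τ.range) →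
      ∀ L : Subgroup (GL (Fin p) K), L ≤ τ.range → (∀ h ∈ τ.range, ∀ x ∈ L, h * x * h⁻¹ ∈ L) →
        (∀ N : Subgroup (GL (Fin p) K), N ≤ τ.range → (∀ h ∈ τ.range, ∀ x ∈ N, h * x * h⁻¹ ∈ N) →
          (∀ x ∈ N, ∃ c : K, ((x : GL (Fin p) K) : Matrix (Fin p) (Fin p) K) = c • 1) ∨ L ≤ N) →
        (∀ g ∈ τ.range, (∀ x ∈ L, g * x * g⁻¹ = x) →
          ∃ c : K, ((g : GL (Fin p) K) : Matrix (Fin p) (Fin p) K) = c • 1) →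
        (glRepresentation L.subtype).IsIrreducible →
        (∀ x ∈ L, Matrix.det ((x : GL (Fin p) K) : Matrix (Fin p) (Fin p) K) = 1) →
        IsSimpleGroup L → p ∣ Nat.card L → p ^ 2 ∣ Nat.card G →
        Subgroup.IsExtendedAdequate τ.range ∨
          (p = 3 ∧ Nonempty (↥L ≃* ↥(alternatingGroup (Fin 6))) ∧
            τ.range ≤ L ⊔ Subgroup.center (GL (Fin p) K))) :
    ght2017_adequate_or_index_p_or_psl29.{u, v} := by
  refine ght2017_adequate_or_index_p_or_psl29_of_socle_odd
    fun p _ K _ _ _ G _ _ τ hp hinj hirr hmono L hLH hLnorm hsocle hcent hirrL hdet hsimple hdvd => ?_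
  by_cases h2 : p ^ 2 ∣ Nat.card G
  · exact hs p K G τ hp hinj hirr hmono L hLH hLnorm hsocle hcent hirrL hdet hsimple hdvd h2
  · left
    haveI : Finite τ.range := Finite.of_surjective _ τ.rangeRestrict_surjective
    have hcard : Nat.card τ.range = Nat.card G :=
      (Nat.card_congr (MonoidHom.ofInjective hinj).toEquiv).symm
    have hp2 : ¬p ^ 2 ∣ Nat.card τ.range := by rwa [hcard]
    obtain ⟨h1, h2'⟩ := Subgroup.addMonoidHom_eq_zero_and_cocycles₁_le_of_primitive_of_not_sq_dvd
      (isIrreducible_range_subtype τ hirr) hmono hp2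
    exact ⟨h1, h2', hw p K G τ hp hinj hirr hmono L hLH hLnorm hsocle hcent hirrL hdet hsimple hdvd h2⟩

end LemmaSixTwoConsequences

/-! ## GHT Lemma 6.2 in general dimension `n` with `p ∣ n`

The same relative-trace argument proves Lemma 6.2 for every `n` divisible by `p`: `Kⁿ` is free over
`K⟨y⟩` — stated as `ker (y - 1) = im (y - 1)^{p-1}` — for a finite `H ≤ GL_n(K)` with scalar
commutant, `p² ∤ |H|`, `y ∈ H` of order `p`.  Instead of the nilpotency index one uses the HEIGHT
`h ≤ p - 2` of a vector `v ∈ ker N ∖ im N^{p-1}` (`N = y - 1`, `v = N^h u`, `v ∉ im N^{h+1}`): with a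
functional `Λ` vanishing on `im N^{h+1}` and `Λ v ≠ 0`, the local splitting endomorphism
`θ = Σ_{j ≤ h} N^j u ⊗ Λ N^{h-j}` commutes with `N` (`mul_localSplitting_comm`) and has trace
`(h + 1) Λ v ≠ 0`. -/

namespace PrimeDegreeClifford

variable {K : Type u} [Field K]

section LocalSplitting

variable {n : ℕ}

/-- The splitting endomorphism in local form: if `N ^ (m' + 1) C = 0` and `R N ^ (m' + 1) = 0` then
`θ = Σ_{j ≤ m'} N^j C R N^{m'-j}` commutes with `N`. [folklore] -/
theorem mul_localSplitting_comm (N : Matrix (Fin n) (Fin n) K) (C : Matrix (Fin n) (Fin 1) K)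
    (R : Matrix (Fin 1) (Fin n) K) (m' : ℕ) (hC : N ^ (m' + 1) * C = 0)
    (hR : R * N ^ (m' + 1) = 0) :
    N * (∑ j ∈ Finset.range (m' + 1), N ^ j * C * R * N ^ (m' - j)) =
      (∑ j ∈ Finset.range (m' + 1), N ^ j * C * R * N ^ (m' - j)) * N := by
  rw [Finset.mul_sum, Finset.sum_mul]
  have hl : ∀ j ∈ Finset.range (m' + 1), N * (N ^ j * C * R * N ^ (m' - j)) =
      N ^ (j + 1) * C * R * N ^ (m' - j) := by
    intro j _
    rw [pow_succ']
    simp only [Matrix.mul_assoc]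
  have hr : ∀ j ∈ Finset.range (m' + 1), N ^ j * C * R * N ^ (m' - j) * N =
      N ^ j * C * R * N ^ (m' - j + 1) := by
    intro j _
    rw [pow_succ]
    simp only [Matrix.mul_assoc]
  rw [Finset.sum_congr rfl hl, Finset.sum_congr rfl hr, Finset.sum_range_succ,
    Finset.sum_range_succ' (fun j => N ^ j * C * R * N ^ (m' - j + 1))]
  have h1 : N ^ (m' + 1) * C * R * N ^ (m' - m') = 0 := by
    rw [hC, Matrix.zero_mul, Matrix.zero_mul]
  have h2 : N ^ 0 * C * R * N ^ (m' - 0 + 1) = 0 := by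
    rw [Nat.sub_zero, pow_zero, Matrix.one_mul, Matrix.mul_assoc, hR, Matrix.mul_zero]
  rw [h1, h2, add_zero, add_zero]
  refine Finset.sum_congr rfl fun j hj => ?_
  rw [Finset.mem_range] at hj
  have e : m' - (j + 1) + 1 = m' - j := by omega
  rw [e]

/-- A linear functional on `Kⁿ` is the dot product with its values on the standard basis.
[folklore] -/
theorem dual_apply_eq_sum (f : Module.Dual K (Fin n → K)) (w : Fin n → K) :
    f w = ∑ j, w j * f (Pi.single j 1) := by
  classical
  rw [LinearMap.pi_apply_eq_sum_univ f w]
  refine Finset.sum_congr rfl fun j _ => ?_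
  rw [smul_eq_mul]
  congr 2
  funext k
  rw [Pi.single_apply]
  by_cases hkj : k = j
  · subst hkj; simp
  · rw [if_neg hkj, if_neg (Ne.symm hkj)]

/-- The row matrix of a functional: `row(f) · X = row(f ∘ X)`. [folklore] -/
theorem replicateRow_dual_mul (f : Module.Dual K (Fin n → K)) (X : Matrix (Fin n) (Fin n) K) :
    Matrix.replicateRow (Fin 1) (fun j => f (Pi.single j 1)) * X =
      Matrix.replicateRow (Fin 1) (fun j => (f ∘ₗ Matrix.toLin' X) (Pi.single j 1)) := by
  ext i j
  rw [Matrix.mul_apply, Matrix.replicateRow_apply, LinearMap.comp_apply, Matrix.toLin'_apply,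
    Matrix.mulVec_single_one, dual_apply_eq_sum]
  refine Finset.sum_congr rfl fun k _ => ?_
  rw [Matrix.replicateRow_apply, mul_comm]
  rfl

/-- `tr (row(f) · col u) = f u`. [folklore] -/
theorem trace_replicateRow_dual_mul_col (f : Module.Dual K (Fin n → K)) (u : Fin n → K) :
    Matrix.trace (Matrix.replicateRow (Fin 1) (fun j => f (Pi.single j 1)) *
      Matrix.replicateCol (Fin 1) u) = f u := by
  rw [Matrix.trace_fin_one, Matrix.mul_apply, dual_apply_eq_sum]
  refine Finset.sum_congr rfl fun k _ => ?_
  rw [Matrix.replicateRow_apply, Matrix.replicateCol_apply, mul_comm]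

end LocalSplitting

section LemmaSixTwoGeneral

variable {n : ℕ} {p : ℕ} [Fact p.Prime] [CharP K p]

/-- **GHT Lemma 6.2, general dimension, classification- and Green-correspondence-free.**  Let
`H ≤ GL_n(K)` be finite with scalar commutant (`char K = p`), `p ∣ n`, `p² ∤ |H|`, and `y ∈ H` of
order `p`, `N = y - 1` (`N ^ p = 0`).  Then `Kⁿ` is FREE over `K⟨y⟩` — every Jordan block of `y`
has size `p` — in the form `ker N = im N^{p-1}`: a vector killed by `N` is `N^{p-1} w`.  (If
`v ∈ ker N` has height exactly `h ≤ p - 2`, `v = N^h u`, pick a functional `Λ` vanishing on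
`im N^{h+1}` with `Λ v = 1`; then `θ = Σ_{j ≤ h} N^j u ⊗ Λ N^{h-j}` commutes with `N` and has trace
`h + 1 ∈ [1, p-1]`, contradicting `trace_eq_zero_of_commute_of_index` for `Q = ⟨y⟩`.)  GHT:
"Let `G` be a finite group with a Sylow `p`-subgroup `P` of order `p` and let `V ∈ IBr_p(G)` be
such that `p ∣ dim V`. Then `V` is projective" — for `|P| = p`, projective = free over `kP`.
[cite: GuralnickHerzigTiep2017, Lemma 6.2] -/
theorem mulVec_eq_zero_iff_exists_of_not_sq_dvd {H : Subgroup (GL (Fin n) K)} [Finite H]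
    (hschur : ∀ M : Matrix (Fin n) (Fin n) K,
      (∀ h ∈ H, ((h : GL (Fin n) K) : Matrix (Fin n) (Fin n) K) * M = M * h) →
        ∃ c : K, M = c • (1 : Matrix (Fin n) (Fin n) K))
    (hn : (n : K) = 0) (hp2 : ¬p ^ 2 ∣ Nat.card H) (y : H) (hy : orderOf y = p)
    (v : Fin n → K) :
    ((((y : H) : GL (Fin n) K) : Matrix (Fin n) (Fin n) K) - 1) *ᵥ v = 0 ↔
      ∃ w, ((((y : H) : GL (Fin n) K) : Matrix (Fin n) (Fin n) K) - 1) ^ (p - 1) *ᵥ w = v := by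
  classical
  have hp : p.Prime := Fact.out
  set Y : Matrix (Fin n) (Fin n) K := (((y : H) : GL (Fin n) K) : Matrix (Fin n) (Fin n) K)
    with hYdef
  -- `N ^ p = 0`
  have hyp : y ^ p = 1 := orderOf_dvd_iff_pow_eq_one.1 (by rw [hy])
  have hYp : Y ^ p = 1 := by
    rw [hYdef, ← Units.val_pow_eq_pow_val, ← Subgroup.coe_pow, hyp, Subgroup.coe_one, Units.val_one]
  have hNp : (Y - 1) ^ p = 0 := by
    rcases Nat.eq_zero_or_pos n with hn0 | hn0
    · subst hn0
      exact Matrix.ext fun a _ => Fin.elim0 a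
    · haveI : Nonempty (Fin n) := ⟨⟨0, hn0⟩⟩
      rw [sub_pow_char_of_commute p (Commute.one_right Y), one_pow, hYp, sub_self]
  constructor
  swap
  · rintro ⟨w, rfl⟩
    rw [Matrix.mulVec_mulVec, ← pow_succ', Nat.sub_add_cancel hp.one_le, hNp, Matrix.zero_mulVec]
  intro hv
  by_contra hnot
  -- the index of `Q = ⟨y⟩` is invertible in `K`
  set Q : Subgroup H := Subgroup.zpowers y with hQdef
  have hQcard : Nat.card Q = p := by rw [hQdef, Nat.card_zpowers, hy]
  have hQidx : ((Q.index : ℕ) : K) ≠ 0 := by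
    intro h0
    rw [CharP.cast_eq_zero_iff K p] at h0
    apply hp2
    rw [← Subgroup.card_mul_index Q, hQcard, pow_two]
    exact Nat.mul_dvd_mul_left p h0
  -- every matrix commuting with `N` has trace zero
  have htr : ∀ θ : Matrix (Fin n) (Fin n) K, (Y - 1) * θ = θ * (Y - 1) → Matrix.trace θ = 0 := by
    intro θ hθ
    have hYθ : Commute Y θ := by
      have e : Y = (Y - 1) + 1 := by abel
      have h1 : Commute (Y - 1) θ := hθ
      rw [e]
      exact h1.add_left (Commute.one_left θ)
    refine trace_eq_zero_of_commute_of_index hschur hn Q hQidx ?_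
    intro q hq
    rw [hQdef] at hq
    obtain ⟨k, rfl⟩ := Subgroup.mem_zpowers_iff.1 hq
    have h2 := hYθ.units_zpow_left k
    rw [Subgroup.coe_zpow]
    exact h2
  -- the height `h ≤ p - 2` of `v`
  have htwo := hp.two_le
  obtain ⟨h, hhle, ⟨u, hu⟩, hnot'⟩ : ∃ h, h ≤ p - 2 ∧ (∃ w, (Y - 1) ^ h *ᵥ w = v) ∧
      ¬∃ w, (Y - 1) ^ (h + 1) *ᵥ w = v := by
    have hP0 : (fun j => ∃ w, (Y - 1) ^ j *ᵥ w = v) 0 := ⟨v, by rw [pow_zero, Matrix.one_mulVec]⟩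
    refine ⟨Nat.findGreatest (fun j => ∃ w, (Y - 1) ^ j *ᵥ w = v) (p - 2), Nat.findGreatest_le _,
      Nat.findGreatest_spec (P := fun j => ∃ w, (Y - 1) ^ j *ᵥ w = v) (Nat.zero_le _) hP0, ?_⟩
    by_cases hlt : Nat.findGreatest (fun j => ∃ w, (Y - 1) ^ j *ᵥ w = v) (p - 2) + 1 ≤ p - 2
    · exact Nat.findGreatest_is_greatest (Nat.lt_succ_self _) hlt
    · have hle := Nat.findGreatest_le (P := fun j => ∃ w, (Y - 1) ^ j *ᵥ w = v) (p - 2)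
      have e : Nat.findGreatest (fun j => ∃ w, (Y - 1) ^ j *ᵥ w = v) (p - 2) + 1 = p - 1 := by
        omega
      rw [e]
      exact hnot
  -- `N ^ (h+1) u = 0`
  have hNu : (Y - 1) ^ (h + 1) *ᵥ u = 0 := by
    rw [pow_succ', ← Matrix.mulVec_mulVec, hu, hv]
  -- a functional vanishing on `im N^{h+1}` with `Λ v ≠ 0`
  have hvW : v ∉ LinearMap.range (Matrix.toLin' ((Y - 1) ^ (h + 1))) := by
    rintro ⟨w, hw⟩
    exact hnot' ⟨w, by rw [← Matrix.toLin'_apply]; exact hw⟩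
  obtain ⟨f, hfv, hfW⟩ :=
    Submodule.exists_dual_map_eq_bot_of_notMem hvW Module.Projective.of_free
  have hfW' : ∀ w, f ((Y - 1) ^ (h + 1) *ᵥ w) = 0 := by
    intro w
    have hmem : f ((Y - 1) ^ (h + 1) *ᵥ w) ∈
        (LinearMap.range (Matrix.toLin' ((Y - 1) ^ (h + 1)))).map f :=
      ⟨(Y - 1) ^ (h + 1) *ᵥ w, ⟨w, by rw [Matrix.toLin'_apply]⟩, rfl⟩
    rw [hfW, Submodule.mem_bot] at hmem
    exact hmem
  -- the splitting endomorphism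
  set C : Matrix (Fin n) (Fin 1) K := Matrix.replicateCol (Fin 1) u with hC
  set R : Matrix (Fin 1) (Fin n) K := Matrix.replicateRow (Fin 1) (fun j => f (Pi.single j 1))
    with hR
  have hCz : (Y - 1) ^ (h + 1) * C = 0 := by
    rw [hC]
    ext i j
    rw [Matrix.mul_apply, Matrix.zero_apply]
    have := congrFun hNu i
    rw [Matrix.mulVec, Pi.zero_apply] at this
    simpa [dotProduct, Matrix.replicateCol_apply] using this
  have hRz : R * (Y - 1) ^ (h + 1) = 0 := by
    rw [hR, replicateRow_dual_mul]
    ext i j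
    rw [Matrix.replicateRow_apply, LinearMap.comp_apply, Matrix.toLin'_apply, hfW',
      Matrix.zero_apply]
  have h1 := htr _ (mul_localSplitting_comm (Y - 1) C R h hCz hRz)
  rw [trace_jordanSplitting, hR, hC, Matrix.mul_assoc, ← Matrix.replicateCol_mulVec,
    trace_replicateRow_dual_mul_col, hu] at h1
  have hcast : ((h + 1 : ℕ) : K) ≠ 0 := by
    rw [Ne, CharP.cast_eq_zero_iff K p]
    intro hd
    have hle := Nat.le_of_dvd (Nat.succ_pos h) hd
    omega
  rcases mul_eq_zero.1 h1 with h0 | h0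
  · exact hcast h0
  · exact hfv h0

end LemmaSixTwoGeneral

end PrimeDegreeClifford

/-- **GHT Lemma 6.2 for an absolutely irreducible `H ≤ GL_n(k)`, any field of characteristic
`p ∣ n`:** if `p² ∤ |H|` then `kⁿ` is free over `k⟨y⟩` for every `y ∈ H` of order `p`
(`ker (y - 1) = im (y - 1)^{p-1}`; "`V` is projective"). [cite: GuralnickHerzigTiep2017, Lemma 6.2] -/
theorem Subgroup.mulVec_eq_zero_iff_exists_of_isAbsIrreducible {k : Type u} [Field k] {p : ℕ}
    [Fact p.Prime] [CharP k p] {n : ℕ} {H : Subgroup (GL (Fin n) k)} [Finite H]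
    (hirr : IsAbsIrreducible H.subtype) (hn : p ∣ n) (hp2 : ¬p ^ 2 ∣ Nat.card H) (y : H)
    (hy : orderOf y = p) (v : Fin n → k) :
    ((((y : H) : GL (Fin n) k) : Matrix (Fin n) (Fin n) k) - 1) *ᵥ v = 0 ↔
      ∃ w, ((((y : H) : GL (Fin n) k) : Matrix (Fin n) (Fin n) k) - 1) ^ (p - 1) *ᵥ w = v :=
  PrimeDegreeClifford.mulVec_eq_zero_iff_exists_of_not_sq_dvd
    (fun _ hM => PrimeDegreeClifford.exists_eq_smul_one_of_span_eq_top
      (PrimeDegreeClifford.span_eq_top_of_isAbsIrreducible hirr) hM)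
    ((CharP.cast_eq_zero_iff k p n).2 hn) hp2 y hy v

/-- **GHT Lemma 6.2 for an irreducible `H ≤ GL_n(K̄)`, `char K = p ∣ n`:** if `p² ∤ |H|` then `Kⁿ`
is free over `K⟨y⟩` for every `y ∈ H` of order `p`. [cite: GuralnickHerzigTiep2017, Lemma 6.2] -/
theorem Subgroup.mulVec_eq_zero_iff_exists_of_isIrreducible {K : Type u} [Field K] [IsAlgClosed K]
    {p : ℕ} [Fact p.Prime] [CharP K p] {n : ℕ} {H : Subgroup (GL (Fin n) K)} [Finite H]
    (hirr : (glRepresentation H.subtype).IsIrreducible) (hn : p ∣ n) (hp2 : ¬p ^ 2 ∣ Nat.card H)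
    (y : H) (hy : orderOf y = p) (v : Fin n → K) :
    ((((y : H) : GL (Fin n) K) : Matrix (Fin n) (Fin n) K) - 1) *ᵥ v = 0 ↔
      ∃ w, ((((y : H) : GL (Fin n) K) : Matrix (Fin n) (Fin n) K) - 1) ^ (p - 1) *ᵥ w = v :=
  PrimeDegreeClifford.mulVec_eq_zero_iff_exists_of_not_sq_dvd
    (fun _ hM => PrimeDegreeClifford.exists_eq_smul_one_of_forall_commute hirr hM)
    ((CharP.cast_eq_zero_iff K p n).2 hn) hp2 y hy v

/-! ## Theorem 1.7 for `p ∥ |G|`: clauses (i) and (ii), or alternative (b), over any field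

Assembling the imprimitive case (Prop. 6.6, `AdequacyDegreeP.lean`), the primitive case above and
the descent of clauses (i), (ii) along `k ↪ k̄`: for a faithful absolutely irreducible
`σ : G →* GL_p(k)` with `p² ∤ |G|`, clauses (i) and (ii) of adequacy hold for `σ(G)` unless `G`
has an abelian normal subgroup of index `p`; so Theorem 1.7 for `p ∥ |G|` holds modulo weak
adequacy (`isExtendedAdequate_or_index_p_of_not_sq_dvd_of_semisimpleSpan`). -/

section NotSqDvd

/-- **Theorem 1.7 for `p ∥ |G|`: clauses (i) and (ii) of adequacy, or alternative (b) —
classification-free, over any field.**  Let `k` be a field of characteristic `p`, `G` a finite group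
with `p² ∤ |G|`, and `σ : G →* GL_p(k)` faithful and absolutely irreducible.  Then EITHER
`Hom(σ(G), k) = 0` and `H¹(σ(G), ad/Z) = 0` (clauses (i), (ii) of extended adequacy), OR `G` has
an abelian normal subgroup of index `p`.  (Over `k̄`: if `σ(G)` permutes the lines of a basis with
non-central kernel `A`, then `[σ(G) : A] = p` gives (b) and `[σ(G) : A] ≠ p` gives adequacy by
Prop. 6.6, `Subgroup.isExtendedAdequate_of_monomial`; otherwise `σ(G)` is primitive and (i), (ii)
hold by `Subgroup.addMonoidHom_eq_zero_and_cocycles₁_le_of_primitive_of_not_sq_dvd` — the simple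
layer, Lemma 6.2 proved here, Burnside's transfer; then descend (i), (ii) to `k` by
`Subgroup.addMonoidHom_eq_zero_of_map`, `Subgroup.cocycles₁_le_coboundaries₁_of_map`.)  What is
missing from Theorem 1.7 for `p ∥ |G|` is thus exactly clause (iii), weak adequacy of the
primitive groups (GHT Thm. 2.2 with Props. 6.7–6.14: CFSG); alternative (c) does not occur for
`p ∥ |G|` (`9 ∣ |A₆|`). [cite: GuralnickHerzigTiep2017, Theorem 1.7, Proposition 6.6,
Lemmas 6.2–6.3, proof of Theorem 6.15 (p. 24)] -/
theorem addMonoidHom_eq_zero_and_cocycles₁_le_or_index_p_of_not_sq_dvd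
    {p : ℕ} [Fact p.Prime] {k : Type u} [Field k] [CharP k p] {G : Type v} [Group G] [Finite G]
    (σ : G →* GL (Fin p) k) (hinj : Function.Injective σ) (hirr : IsAbsIrreducible σ)
    (hp2 : ¬p ^ 2 ∣ Nat.card G) :
    ((∀ f : Additive σ.range →+ k, f = 0) ∧
      groupCohomology.cocycles₁ (Rep.of (Subgroup.adModScalarRep σ.range)) ≤
        groupCohomology.coboundaries₁ (Rep.of (Subgroup.adModScalarRep σ.range))) ∨
    ∃ A : Subgroup G, A.Normal ∧ (∀ x ∈ A, ∀ y ∈ A, x * y = y * x) ∧ A.index = p := by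
  classical
  let K := AlgebraicClosure k
  let ι : k →+* K := algebraMap k K
  haveI : CharP K p := charP_of_injective_ringHom ι.injective p
  let τ : G →* GL (Fin p) K := (Matrix.GeneralLinearGroup.map ι).comp σ
  have hτinj : Function.Injective τ := (glMap_injective_of_ringHom ι).comp hinj
  have hτirr : (glRepresentation τ).IsIrreducible := hirr K ι
  haveI : Finite τ.range := Finite.of_surjective _ τ.rangeRestrict_surjective
  have hirr' := isIrreducible_range_subtype τ hτirr
  have hcard : Nat.card τ.range = Nat.card G :=
    (Nat.card_congr (MonoidHom.ofInjective hτinj).toEquiv).symm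
  have hp2' : ¬p ^ 2 ∣ Nat.card τ.range := by rwa [hcard]
  -- descent of (i), (ii) from `τ(G) = GL_p(ι)(σ(G))` to `σ(G)`
  have hdesc : (∀ f : Additive τ.range →+ K, f = 0) ∧
      groupCohomology.cocycles₁ (Rep.of (Subgroup.adModScalarRep τ.range)) ≤
        groupCohomology.coboundaries₁ (Rep.of (Subgroup.adModScalarRep τ.range)) →
      (∀ f : Additive σ.range →+ k, f = 0) ∧
        groupCohomology.cocycles₁ (Rep.of (Subgroup.adModScalarRep σ.range)) ≤
          groupCohomology.coboundaries₁ (Rep.of (Subgroup.adModScalarRep σ.range)) := by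
    rintro ⟨h1, h2⟩
    refine ⟨Subgroup.addMonoidHom_eq_zero_of_map ι σ.range ?_,
      Subgroup.cocycles₁_le_coboundaries₁_of_map ι σ.range ?_⟩
    · rw [MonoidHom.map_range]; exact h1
    · rw [MonoidHom.map_range]; exact h2
  by_cases hmono : ∀ (b : Module.Basis (Fin p) K (Fin p → K)) (θ : ↥τ.range →* Equiv.Perm (Fin p)),
      (∀ (h : τ.range) (i : Fin p), ∃ c : K,
        ((h : GL (Fin p) K) : Matrix (Fin p) (Fin p) K) *ᵥ b i = c • b (θ h i)) →
      θ.ker ≤ Subgroup.center τ.range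
  · -- primitive: (i), (ii) by the simple layer and Lemma 6.2
    exact Or.inl (hdesc
      (Subgroup.addMonoidHom_eq_zero_and_cocycles₁_le_of_primitive_of_not_sq_dvd hirr' hmono hp2'))
  simp only [not_forall] at hmono
  obtain ⟨b, θ, hθ, hA⟩ := hmono
  rcases eq_or_ne θ.ker.index p with hidx | hidx
  · -- `[τ(G) : A] = p`: the pull-back of `A` is an abelian normal subgroup of index `p`
    refine Or.inr ⟨θ.ker.comap τ.rangeRestrict, inferInstance, ?_, ?_⟩
    · choose c hc using hθ
      intro x hx y hy
      apply hτinj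
      have hx' : θ (τ.rangeRestrict x) = 1 := (MonoidHom.mem_ker).1 hx
      have hy' : θ (τ.rangeRestrict y) = 1 := (MonoidHom.mem_ker).1 hy
      have hdx := MonomialAdequacy.mulVec_basis_of_ker b θ c hc (τ.rangeRestrict x) hx'
      have hdy := MonomialAdequacy.mulVec_basis_of_ker b θ c hc (τ.rangeRestrict y) hy'
      simp only [MonoidHom.coe_rangeRestrict] at hdx hdy
      rw [map_mul, map_mul]
      apply Units.ext
      rw [Units.val_mul, Units.val_mul]
      refine MonomialAdequacy.matrix_eq_of_mulVec_basis b fun i => ?_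
      rw [← Matrix.mulVec_mulVec, ← Matrix.mulVec_mulVec, hdx, hdy, Matrix.mulVec_smul,
        Matrix.mulVec_smul, hdx, hdy, smul_smul, smul_smul, mul_comm]
    · rw [Subgroup.index_comap_of_surjective θ.ker τ.rangeRestrict_surjective, hidx]
  · -- `[τ(G) : A] ≠ p`: adequate by Prop. 6.6
    have had := Subgroup.isExtendedAdequate_of_monomial τ.range hirr' b θ hθ hA hidx
    exact Or.inl (hdesc ⟨had.addMonoidHom_eq_zero, had.cocycles₁_le_coboundaries₁⟩)

/-- **Theorem 1.7 for `p ∥ |G|` modulo weak adequacy.**  Under the hypotheses of Theorem 1.7 with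
`p² ∤ |G|`, if moreover `M_p(k)` is spanned by the `p'`-elements of `σ(G)` (clause (iii), weak
adequacy), then `σ(G)` is adequate or `G` has an abelian normal subgroup of index `p`.
[cite: GuralnickHerzigTiep2017, Theorem 1.7, Proposition 6.6, Lemmas 6.2–6.3] -/
theorem isExtendedAdequate_or_index_p_of_not_sq_dvd_of_semisimpleSpan
    {p : ℕ} [Fact p.Prime] {k : Type u} [Field k] [CharP k p] {G : Type v} [Group G] [Finite G]
    (σ : G →* GL (Fin p) k) (hinj : Function.Injective σ) (hirr : IsAbsIrreducible σ)
    (hp2 : ¬p ^ 2 ∣ Nat.card G) (hw : Subgroup.semisimpleSpan σ.range = ⊤) :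
    Subgroup.IsExtendedAdequate σ.range ∨
      ∃ A : Subgroup G, A.Normal ∧ (∀ x ∈ A, ∀ y ∈ A, x * y = y * x) ∧ A.index = p := by
  rcases addMonoidHom_eq_zero_and_cocycles₁_le_or_index_p_of_not_sq_dvd σ hinj hirr hp2 with
    ⟨h1, h2⟩ | hb
  · exact Or.inl ⟨h1, h2, hw⟩
  · exact Or.inr hb

end NotSqDvd

/-! ## Theorem 1.7 for solvable groups, unconditionally

A primitive irreducible group of prime degree `p` in characteristic `p` has a simple
non-commutative layer, so it is not solvable; hence for SOLVABLE `G` only the imprimitive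
dichotomy of Prop. 6.6 occurs and Theorem 1.7 holds in full: (a) or (b)
(`isExtendedAdequate_or_index_p_of_isSolvable`). -/

section Solvable

/-- **A primitive irreducible group of prime degree `p` in characteristic `p` is not solvable**
(`K = K̄`): its simple layer `L` (`Subgroup.exists_simple_normal_dvd_card_of_primitive`) is
irreducible, hence non-commutative, hence not solvable. [cite: GuralnickHerzigTiep2017,
Proposition 6.5 (ii) ("`G` is almost quasisimple")] -/
theorem Subgroup.not_isSolvable_of_primitive {K : Type u} [Field K] [IsAlgClosed K]
    {p : ℕ} [Fact p.Prime] [CharP K p] {H : Subgroup (GL (Fin p) K)} [Finite H]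
    (hirrH : (glRepresentation H.subtype).IsIrreducible)
    (hmono : ∀ (b : Module.Basis (Fin p) K (Fin p → K)) (θ : ↥H →* Equiv.Perm (Fin p)),
      (∀ (h : H) (i : Fin p), ∃ c : K,
        ((h : GL (Fin p) K) : Matrix (Fin p) (Fin p) K) *ᵥ b i = c • b (θ h i)) →
      θ.ker ≤ Subgroup.center H) :
    ¬IsSolvable H := by
  intro hsolv
  obtain ⟨L, hLH, -, hirrL, -, hsimple, -, -, -⟩ :=
    Subgroup.exists_simple_normal_dvd_card_of_primitive hirrH hmono
  haveI : IsSimpleGroup L := hsimple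
  haveI : IsSolvable L :=
    solvable_of_solvable_injective (Subgroup.inclusion_injective hLH)
  have hcomm : ∀ a b : L, a * b = b * a := IsSimpleGroup.comm_iff_isSolvable.2 inferInstance
  exact PrimeDegreeClifford.not_isIrreducible_of_comm (A := L)
    (fun x hx y hy => congrArg Subtype.val (hcomm ⟨x, hx⟩ ⟨y, hy⟩)) hirrL

/-- **Theorem 1.7 for solvable groups, unconditionally** (any field of characteristic `p`, any
`p`).  If `G` is a finite SOLVABLE group and `σ : G →* GL_p(k)` is faithful and absolutely
irreducible, then `σ(G)` is adequate in the extended sense or `G` has an abelian normal subgroup of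
index `p`.  (Over `k̄` a solvable irreducible group of degree `p` cannot be primitive —
`Subgroup.not_isSolvable_of_primitive` — so it permutes the lines of a basis with non-central
kernel `A`: `[σ(G) : A] = p` is alternative (b), `[σ(G) : A] ≠ p` gives adequacy by Prop. 6.6,
which descends to `k`.)  This is the part of Theorem 1.7 where alternative (b) lives (GHT
Theorem 1.3 (ii): for `d = p`, `H¹(G, k) ≠ 0` forces `G` solvable with (b)); no classification
input. [cite: GuralnickHerzigTiep2017, Theorem 1.7, Proposition 6.5, Proposition 6.6] -/
theorem isExtendedAdequate_or_index_p_of_isSolvable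
    {p : ℕ} [Fact p.Prime] {k : Type u} [Field k] [CharP k p] {G : Type v} [Group G] [Finite G]
    [IsSolvable G] (σ : G →* GL (Fin p) k) (hinj : Function.Injective σ)
    (hirr : IsAbsIrreducible σ) :
    Subgroup.IsExtendedAdequate σ.range ∨
      ∃ A : Subgroup G, A.Normal ∧ (∀ x ∈ A, ∀ y ∈ A, x * y = y * x) ∧ A.index = p := by
  classical
  let K := AlgebraicClosure k
  let ι : k →+* K := algebraMap k K
  haveI : CharP K p := charP_of_injective_ringHom ι.injective p
  let τ : G →* GL (Fin p) K := (Matrix.GeneralLinearGroup.map ι).comp σ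
  have hτinj : Function.Injective τ := (glMap_injective_of_ringHom ι).comp hinj
  have hτirr : (glRepresentation τ).IsIrreducible := hirr K ι
  haveI : Finite τ.range := Finite.of_surjective _ τ.rangeRestrict_surjective
  haveI : IsSolvable τ.range := solvable_of_surjective τ.rangeRestrict_surjective
  have hirr' := isIrreducible_range_subtype τ hτirr
  by_cases hmono : ∀ (b : Module.Basis (Fin p) K (Fin p → K)) (θ : ↥τ.range →* Equiv.Perm (Fin p)),
      (∀ (h : τ.range) (i : Fin p), ∃ c : K,
        ((h : GL (Fin p) K) : Matrix (Fin p) (Fin p) K) *ᵥ b i = c • b (θ h i)) →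
      θ.ker ≤ Subgroup.center τ.range
  · exact absurd (inferInstance : IsSolvable τ.range) (Subgroup.not_isSolvable_of_primitive hirr' hmono)
  simp only [not_forall] at hmono
  obtain ⟨b, θ, hθ, hA⟩ := hmono
  rcases eq_or_ne θ.ker.index p with hidx | hidx
  · -- `[τ(G) : A] = p`: the pull-back of `A` is an abelian normal subgroup of index `p`
    refine Or.inr ⟨θ.ker.comap τ.rangeRestrict, inferInstance, ?_, ?_⟩
    · choose c hc using hθ
      intro x hx y hy
      apply hτinj
      have hx' : θ (τ.rangeRestrict x) = 1 := (MonoidHom.mem_ker).1 hx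
      have hy' : θ (τ.rangeRestrict y) = 1 := (MonoidHom.mem_ker).1 hy
      have hdx := MonomialAdequacy.mulVec_basis_of_ker b θ c hc (τ.rangeRestrict x) hx'
      have hdy := MonomialAdequacy.mulVec_basis_of_ker b θ c hc (τ.rangeRestrict y) hy'
      simp only [MonoidHom.coe_rangeRestrict] at hdx hdy
      rw [map_mul, map_mul]
      apply Units.ext
      rw [Units.val_mul, Units.val_mul]
      refine MonomialAdequacy.matrix_eq_of_mulVec_basis b fun i => ?_
      rw [← Matrix.mulVec_mulVec, ← Matrix.mulVec_mulVec, hdx, hdy, Matrix.mulVec_smul,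
        Matrix.mulVec_smul, hdx, hdy, smul_smul, smul_smul, mul_comm]
    · rw [Subgroup.index_comap_of_surjective θ.ker τ.rangeRestrict_surjective, hidx]
  · -- `[τ(G) : A] ≠ p`: adequate by Prop. 6.6, then descend to `k`
    have had := Subgroup.isExtendedAdequate_of_monomial τ.range hirr' b θ hθ hA hidx
    refine Or.inl (Subgroup.IsExtendedAdequate.of_map ι σ.range ?_)
    rw [MonoidHom.map_range]
    exact had

end Solvable

/-! ## Weak adequacy for `p ∥ |H|` is decided by the powers of one `p`-element

Every element of a finite `H ≤ GL_p(K)` with `p ∥ |H|` is the commuting product of a `p'`-element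
and an element of order `1` or `p`; the latter is conjugate to a power `y^j` of a fixed `y` of
order `p` (Sylow), and the former then commutes with a regular unipotent (Lemma 6.2), so it is a
polynomial in it (`mem_span_pow_of_commute_of_cyclicBasis`) and, being `p`-regular, a scalar
(`exists_eq_smul_one_of_mem_span_pow`).  Hence the span of the `p'`-elements is `M_p(K)` iff it
contains all `y^j` (`semisimpleSpan_eq_top_iff_forall_pow_mem`), and the residual hypothesis of
Theorem 1.7 for `p ∥ |G|` becomes: the powers of a regular unipotent of `τ(G)` lie in the span of
its `p'`-elements (`ght2017_adequate_or_index_p_or_psl29_of_socle_odd_pow`). -/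

open scoped Pointwise

namespace PrimeDegreeClifford

variable {K : Type u} [Field K] {p : ℕ} [Fact p.Prime]

section RegularUnipotent

/-- **The commutant of a matrix with a cyclic basis is the span of its powers.**  If `Y e_w =
e_{w+1}` for a basis `(e_w)_{w ∈ ℤ/p}` (one Jordan block), every matrix commuting with `Y` is a
`K`-linear combination of `1, Y, …, Y^{p-1}`. [folklore] -/
theorem mem_span_pow_of_commute_of_cyclicBasis (Y : GL (Fin p) K)
    (e : Module.Basis (ZMod p) K (Fin p → K))
    (he : ∀ w, ((Y : GL (Fin p) K) : Matrix (Fin p) (Fin p) K) *ᵥ e w = e (w + 1))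
    {X : Matrix (Fin p) (Fin p) K}
    (hX : ((Y : GL (Fin p) K) : Matrix (Fin p) (Fin p) K) * X = X * Y) :
    X ∈ Submodule.span K (Set.range fun w : ZMod p =>
      ((Y ^ w.val : GL (Fin p) K) : Matrix (Fin p) (Fin p) K)) := by
  classical
  set a : ZMod p → K := fun w => e.repr (X *ᵥ e 0) w with ha
  set F : Matrix (Fin p) (Fin p) K :=
    ∑ w, a w • ((Y ^ w.val : GL (Fin p) K) : Matrix (Fin p) (Fin p) K) with hF
  have hcomm : ∀ n : ℕ, ((Y ^ n : GL (Fin p) K) : Matrix (Fin p) (Fin p) K) * X =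
      X * ((Y ^ n : GL (Fin p) K) : Matrix (Fin p) (Fin p) K) := by
    intro n
    rw [Units.val_pow_eq_pow_val]
    have hc : Commute ((Y : GL (Fin p) K) : Matrix (Fin p) (Fin p) K) X := hX
    exact hc.pow_left n
  have hrepr : X *ᵥ e 0 = ∑ v, a v • e v := by
    have h := e.sum_repr (X *ᵥ e 0)
    simpa only [ha] using h.symm
  have hXF : X = F := by
    apply Matrix.toLin'.injective
    refine e.ext fun w => ?_
    rw [Matrix.toLin'_apply, Matrix.toLin'_apply]
    have hew : e w = ((Y ^ w.val : GL (Fin p) K) : Matrix (Fin p) (Fin p) K) *ᵥ e 0 := by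
      rw [MonomialAdequacy.pow_mulVec_cyclicBasis Y e he, zero_add, ZMod.natCast_zmod_val]
    have h1 : X *ᵥ e w = ∑ v, a v • e (v + w) := by
      rw [hew, Matrix.mulVec_mulVec, ← hcomm, ← Matrix.mulVec_mulVec, hrepr, Matrix.mulVec_sum]
      refine Finset.sum_congr rfl fun v _ => ?_
      rw [Matrix.mulVec_smul, MonomialAdequacy.pow_mulVec_cyclicBasis Y e he, ZMod.natCast_zmod_val]
    have h2 : F *ᵥ e w = ∑ v, a v • e (w + v) := by
      rw [hF, Matrix.sum_mulVec]
      refine Finset.sum_congr rfl fun v _ => ?_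
      rw [Matrix.smul_mulVec, MonomialAdequacy.pow_mulVec_cyclicBasis Y e he,
        ZMod.natCast_zmod_val]
    rw [h1, h2]
    exact Finset.sum_congr rfl fun v _ => by rw [add_comm]
  rw [hXF, hF]
  exact Submodule.sum_mem _ fun w _ => Submodule.smul_mem _ _ (Submodule.subset_span ⟨w, rfl⟩)

/-- **A `p`-regular element of `K[y]` is a scalar** (`y` unipotent of order `p`).  If
`g ∈ GL_p(K)` is a `K`-linear combination of powers of `Y` (`Y ^ p = 1`, `char K = p`) and
`g ^ m = 1` with `p ∤ m`, then `g` is a scalar: `g = c · 1 + N Q` with `N = Y - 1`, so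
`u = c⁻¹ g` is unipotent, `u ^ p = 1`, and `u ^ m` is a scalar `d` with `d ^ p = 1`, `d = 1`;
hence `u = 1`. [folklore] -/
theorem exists_eq_smul_one_of_mem_span_pow [CharP K p] (Y : GL (Fin p) K) (hY : Y ^ p = 1)
    {g : GL (Fin p) K}
    (hg : ((g : GL (Fin p) K) : Matrix (Fin p) (Fin p) K) ∈ Submodule.span K
      (Set.range fun w : ZMod p => ((Y ^ w.val : GL (Fin p) K) : Matrix (Fin p) (Fin p) K)))
    {m : ℕ} (hm : g ^ m = 1) (hpm : p.Coprime m) :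
    ∃ c : K, ((g : GL (Fin p) K) : Matrix (Fin p) (Fin p) K) = c • 1 := by
  classical
  have hp : p.Prime := Fact.out
  haveI : Nonempty (Fin p) := ⟨⟨0, hp.pos⟩⟩
  obtain ⟨a, ha⟩ := (Submodule.mem_span_range_iff_exists_fun K).1 hg
  set Ym : Matrix (Fin p) (Fin p) K := ((Y : GL (Fin p) K) : Matrix (Fin p) (Fin p) K) with hYm
  have hYp : Ym ^ p = 1 := by
    rw [hYm, ← Units.val_pow_eq_pow_val, hY, Units.val_one]
  have hNp : (Ym - 1) ^ p = 0 := by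
    rw [sub_pow_char_of_commute p (Commute.one_right Ym), one_pow, hYp, sub_self]
  -- `g = c • 1 + N * Q` with `Q` a polynomial in `Y`
  set c : K := ∑ w, a w with hc
  set Q : Matrix (Fin p) (Fin p) K :=
    ∑ w, a w • ∑ i ∈ Finset.range w.val, Ym ^ i with hQ
  have hgm : ((g : GL (Fin p) K) : Matrix (Fin p) (Fin p) K) = c • 1 + (Ym - 1) * Q := by
    rw [← ha, hQ, Finset.mul_sum, hc, Finset.sum_smul, ← Finset.sum_add_distrib]
    refine Finset.sum_congr rfl fun w _ => ?_
    rw [Matrix.mul_smul, mul_geom_sum, Units.val_pow_eq_pow_val, ← hYm, smul_sub]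
    abel
  have hYQ : Commute Ym Q := by
    rw [hQ]
    refine Commute.sum_right _ _ _ fun w _ => Commute.smul_right ?_ _
    exact Commute.sum_right _ _ _ fun i _ => Commute.pow_right (Commute.refl Ym) i
  have hNQ : Commute (Ym - 1) Q := hYQ.sub_left (Commute.one_left Q)
  have hMp : ((Ym - 1) * Q) ^ p = 0 := by
    rw [hNQ.mul_pow, hNp, Matrix.zero_mul]
  -- `c ≠ 0`
  have hc0 : c ≠ 0 := by
    intro h0
    rw [h0, zero_smul, zero_add] at hgm
    have h1 : (((g ^ p : GL (Fin p) K) : GL (Fin p) K) : Matrix (Fin p) (Fin p) K) = 0 := by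
      rw [Units.val_pow_eq_pow_val, hgm, hMp]
    exact Units.ne_zero _ h1
  -- the unipotent `u = c⁻¹ g`
  set u : Matrix (Fin p) (Fin p) K := 1 + c⁻¹ • ((Ym - 1) * Q) with hu
  have hgu : ((g : GL (Fin p) K) : Matrix (Fin p) (Fin p) K) = c • u := by
    rw [hu, smul_add, smul_smul, mul_inv_cancel₀ hc0, one_smul, hgm]
  have hup : u ^ p = 1 := by
    rw [hu, add_pow_char_of_commute p (Commute.one_left _), one_pow, smul_pow, hMp, smul_zero,
      add_zero]
  have hum : u ^ m = (c ^ m)⁻¹ • (1 : Matrix (Fin p) (Fin p) K) := by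
    have h1 : (c • u) ^ m = 1 := by
      rw [← hgu, ← Units.val_pow_eq_pow_val, hm, Units.val_one]
    rw [smul_pow] at h1
    have h2 : (c ^ m)⁻¹ • (c ^ m • u ^ m) = (c ^ m)⁻¹ • (1 : Matrix (Fin p) (Fin p) K) := by
      rw [h1]
    rwa [smul_smul, inv_mul_cancel₀ (pow_ne_zero m hc0), one_smul] at h2
  -- the scalar `d = (c ^ m)⁻¹` satisfies `d ^ p = 1`, so `d = 1`
  have hd : ((c ^ m)⁻¹) ^ p = 1 := by
    have h1 : (u ^ m) ^ p = 1 := by rw [← pow_mul, mul_comm, pow_mul, hup, one_pow]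
    rw [hum, smul_pow, one_pow] at h1
    have h2 := congrFun (congrFun h1 ⟨0, hp.pos⟩) ⟨0, hp.pos⟩
    simpa using h2
  have hd1 : (c ^ m)⁻¹ = 1 := by
    have h1 : ((c ^ m)⁻¹ - 1) ^ p = 0 := by
      rw [sub_pow_char _ _, hd, one_pow, sub_self]
    exact sub_eq_zero.1 (pow_eq_zero_iff hp.ne_zero |>.1 h1)
  rw [hd1, one_smul] at hum
  -- `u ^ p = 1 = u ^ m` with `gcd(p, m) = 1` forces `u = 1`
  have hu1 : u = 1 := by
    have h1 : orderOf u ∣ p := orderOf_dvd_of_pow_eq_one hup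
    have h2 : orderOf u ∣ m := orderOf_dvd_of_pow_eq_one hum
    exact orderOf_eq_one_iff.1 (Nat.eq_one_of_dvd_coprimes hpm h1 h2)
  refine ⟨c, ?_⟩
  rw [hgu, hu1]

end RegularUnipotent

section WeakAdequacyCriterion

variable [CharP K p]

/-- **Weak adequacy for `p ∥ |H|` is decided by the powers of one `p`-element.**  Let
`H ≤ GL_p(K)` be finite with `K⟨H⟩ = M_p(K)` (absolutely irreducible), `char K = p`, `p² ∤ |H|`,
and `y ∈ H` of order `p`.  Then `M_p(K)` is spanned by the `p'`-elements of `H` iff every power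
`y^j` lies in that span.  (Every `h ∈ H` is `h_s h_u` with commuting powers `h_s` of `p'`-order and
`h_u` of order `1` or `p`; if `h_u ≠ 1` it is conjugate to some `y^j` (Sylow), and `h_s`,
commuting with a regular unipotent — `y` is one Jordan block by Lemma 6.2,
`exists_cyclicBasis_of_not_sq_dvd` — is a polynomial in it (`mem_span_pow_of_commute_of_cyclicBasis`)
of `p'`-order, hence a scalar (`exists_eq_smul_one_of_mem_span_pow`); so `h = c · x⁻¹ y^j x` lies
in the span as soon as `y^j` does.) [cite: GuralnickHerzigTiep2017, §1 p. 3 (weak adequacy),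
Lemma 6.2] -/
theorem semisimpleSpan_eq_top_iff_forall_pow_mem {H : Subgroup (GL (Fin p) K)} [Finite H]
    (hspan : Submodule.span K
      (Set.range fun h : H => ((h : GL (Fin p) K) : Matrix (Fin p) (Fin p) K)) = ⊤)
    (hp2 : ¬p ^ 2 ∣ Nat.card H) (y : H) (hy : orderOf y = p) :
    Subgroup.semisimpleSpan H = ⊤ ↔
      ∀ j : ℕ, (((y ^ j : H) : GL (Fin p) K) : Matrix (Fin p) (Fin p) K) ∈
        Subgroup.semisimpleSpan H := by
  classical
  refine ⟨fun h j => h ▸ Submodule.mem_top, fun hyj => ?_⟩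
  have hp : p.Prime := Fact.out
  have hchar : ringChar K = p := ringChar.eq K p
  -- a cyclic basis for `y` (Lemma 6.2)
  obtain ⟨e, he⟩ := exists_cyclicBasis_of_not_sq_dvd
    (fun _ hM => exists_eq_smul_one_of_span_eq_top hspan hM) hp2 y hy
  have hyp : (y : GL (Fin p) K) ^ p = 1 := by
    rw [← Subgroup.coe_pow, orderOf_dvd_iff_pow_eq_one.1 (by rw [hy]), Subgroup.coe_one]
  obtain ⟨Py, -, hPy⟩ := sylow_eq_zpowers_of_not_sq_dvd y hy hp2
  -- every element of `H` lies in the span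
  suffices hall : ∀ h : H, ((h : GL (Fin p) K) : Matrix (Fin p) (Fin p) K) ∈
      Subgroup.semisimpleSpan H by
    rw [eq_top_iff, ← hspan, Submodule.span_le]
    rintro _ ⟨h, rfl⟩
    exact hall h
  intro h
  have hyp0 : y ^ p = 1 := orderOf_dvd_iff_pow_eq_one.1 (by rw [hy])
  by_cases hpn : p ∣ orderOf h
  swap
  · -- `h` is `p`-regular
    refine Subgroup.mem_semisimpleSpan_of_coprime H h ?_
    rw [hchar, Subgroup.orderOf_coe, Nat.coprime_comm]
    exact (Nat.Prime.coprime_iff_not_dvd hp).2 hpn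
  -- `orderOf h = p m` with `p ∤ m`
  obtain ⟨m, hm⟩ := hpn
  have hmp : ¬p ∣ m := by
    intro hdvd
    apply hp2
    have h1 : orderOf h ∣ Nat.card H := orderOf_dvd_natCard h
    rw [pow_two]
    exact (hm ▸ Nat.mul_dvd_mul_left p hdvd).trans h1
  have hcop : Nat.Coprime m p := (Nat.coprime_comm).1 ((Nat.Prime.coprime_iff_not_dvd hp).2 hmp)
  obtain ⟨t, -, ht⟩ := Nat.exists_mul_mod_eq_one_of_coprime hcop hp.one_lt
  -- the `p`-part `hu` and the `p'`-part `hs`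
  set hu : H := h ^ (m * t) with hhu
  set hs : H := h * hu⁻¹ with hhs
  have hdecomp : h = hs * hu := by rw [hhs, inv_mul_cancel_right]
  have hup : hu ^ p = 1 := by
    have e : m * t * p = orderOf h * t := by rw [hm]; ring
    rw [hhu, ← pow_mul, e, pow_mul, pow_orderOf_eq_one, one_pow]
  have hu1 : hu ≠ 1 := by
    intro h1
    rw [hhu, ← orderOf_dvd_iff_pow_eq_one, hm] at h1
    have h2 : p ∣ m * t := (Dvd.intro m rfl).trans h1
    have h3 : m * t % p = 0 := Nat.mod_eq_zero_of_dvd h2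
    omega
  have hou : orderOf hu = p := orderOf_eq_prime hup hu1
  have hsm : hs ^ m = 1 := by
    have hcomm : Commute h hu⁻¹ := (Commute.self_pow h (m * t)).inv_right
    rw [hhs, hcomm.mul_pow, inv_pow, hhu, ← pow_mul]
    have e1 : h ^ (m * t * m) = h ^ m := by
      rw [pow_eq_pow_iff_modEq, hm]
      -- `m t m ≡ m (mod p m)` since `m t ≡ 1 (mod p)`
      have h1 : m * t ≡ 1 [MOD p] := by
        rw [Nat.ModEq, ht, Nat.mod_eq_of_lt hp.one_lt]
      have h3 : m * t * m ≡ 1 * m [MOD p * m] := h1.mul_right' m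
      rwa [one_mul] at h3
    rw [e1, mul_inv_cancel]
  have hscop : (orderOf (hs : GL (Fin p) K)).Coprime (ringChar K) := by
    rw [hchar, Subgroup.orderOf_coe]
    exact Nat.Coprime.coprime_dvd_left (orderOf_dvd_of_pow_eq_one hsm) hcop
  -- `hu` is conjugate to a power of `y` (Sylow)
  obtain ⟨Pu, -, hPu⟩ := sylow_eq_zpowers_of_not_sq_dvd hu hou hp2
  obtain ⟨x, hx⟩ := MulAction.exists_smul_eq H Pu Py
  have hconj : x * hu * x⁻¹ ∈ Subgroup.zpowers y := by
    have h1 : hu ∈ (Pu : Subgroup H) := by rw [hPu]; exact Subgroup.mem_zpowers hu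
    have h2 : MulAut.conj x • hu ∈ MulAut.conj x • (Pu : Subgroup H) :=
      Subgroup.smul_mem_pointwise_smul _ _ _ h1
    rw [← Sylow.coe_subgroup_smul, hx, hPy, MulAut.smul_def, MulAut.conj_apply] at h2
    exact h2
  rw [← mem_powers_iff_mem_zpowers, Submonoid.mem_powers_iff] at hconj
  obtain ⟨j, hj⟩ := hconj
  -- `X = x hs x⁻¹` commutes with `y ^ j = x hu x⁻¹`, hence with `y`
  set X : H := x * hs * x⁻¹ with hXdef
  have hXyj : Commute X (y ^ j) := by
    rw [hj, hXdef]
    have hc : Commute hs hu := by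
      rw [hhs, hhu]
      exact (Commute.self_pow h (m * t)).mul_left (Commute.refl _).inv_left
    change x * hs * x⁻¹ * (x * hu * x⁻¹) = x * hu * x⁻¹ * (x * hs * x⁻¹)
    have := hc.eq
    calc x * hs * x⁻¹ * (x * hu * x⁻¹) = x * (hs * hu) * x⁻¹ := by group
      _ = x * (hu * hs) * x⁻¹ := by rw [this]
      _ = x * hu * x⁻¹ * (x * hs * x⁻¹) := by group
  have hyj1 : y ^ j ≠ 1 := by
    intro h1
    rw [h1] at hj
    apply hu1
    have h2 : x * hu * x⁻¹ = 1 := hj.symm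
    calc hu = x⁻¹ * (x * hu * x⁻¹) * x := by group
      _ = 1 := by rw [h2]; group
  have hoyj : orderOf (y ^ j) = p :=
    orderOf_eq_prime (by rw [← pow_mul, mul_comm, pow_mul, hyp0, one_pow]) hyj1
  have hymem : y ∈ Subgroup.zpowers (y ^ j) := by
    have hle : Subgroup.zpowers (y ^ j) ≤ Subgroup.zpowers y :=
      Subgroup.zpowers_le.2 (Subgroup.pow_mem _ (Subgroup.mem_zpowers y) j)
    have heq : Subgroup.zpowers (y ^ j) = Subgroup.zpowers y := by
      apply Subgroup.eq_of_le_of_card_ge hle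
      rw [Nat.card_zpowers, Nat.card_zpowers, hy, hoyj]
    rw [heq]
    exact Subgroup.mem_zpowers y
  obtain ⟨i, hi⟩ := Subgroup.mem_zpowers_iff.1 hymem
  have hXy : Commute X y := by
    rw [← hi]
    exact hXyj.zpow_right i
  -- matrix level: `X` is a polynomial in `y`, of `p'`-order, hence a scalar
  have hXmat : ((y : GL (Fin p) K) : Matrix (Fin p) (Fin p) K) * ((X : H) : GL (Fin p) K) =
      (((X : H) : GL (Fin p) K) : Matrix (Fin p) (Fin p) K) * ((y : H) : GL (Fin p) K) := by
    have h1 := congrArg (fun z : H => ((z : GL (Fin p) K) : Matrix (Fin p) (Fin p) K)) hXy.eq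
    simpa only [Subgroup.coe_mul, Units.val_mul] using h1.symm
  have hXspan := mem_span_pow_of_commute_of_cyclicBasis (y : GL (Fin p) K) e he hXmat
  have hXm : ((X : H) : GL (Fin p) K) ^ m = 1 := by
    rw [← Subgroup.coe_pow, hXdef]
    have e1 : (x * hs * x⁻¹) ^ m = x * hs ^ m * x⁻¹ := by
      rw [conj_pow]
    rw [e1, hsm, mul_one, mul_inv_cancel, Subgroup.coe_one]
  obtain ⟨c, hc⟩ := exists_eq_smul_one_of_mem_span_pow (y : GL (Fin p) K) hyp hXspan hXm
    ((Nat.coprime_comm).1 hcop)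
  -- `hs = x⁻¹ X x` is the same scalar
  have hsmat : ((hs : GL (Fin p) K) : Matrix (Fin p) (Fin p) K) = c • 1 := by
    have e1 : hs = x⁻¹ * X * x := by rw [hXdef]; group
    rw [e1, Subgroup.coe_mul, Subgroup.coe_mul, Units.val_mul, Units.val_mul, hc, Matrix.mul_smul,
      Matrix.mul_one, Matrix.smul_mul, Subgroup.coe_inv, ← Units.val_mul, inv_mul_cancel,
      Units.val_one]
  -- `hu = x⁻¹ y^j x` lies in the span, and so does `h = c • hu`
  have humem : ((hu : GL (Fin p) K) : Matrix (Fin p) (Fin p) K) ∈ Subgroup.semisimpleSpan H := by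
    have e1 : hu = x⁻¹ * y ^ j * x := by rw [hj]; group
    have h1 := Subgroup.adRep_apply_mem_semisimpleSpan H x⁻¹ (hyj j)
    rw [Subgroup.adRep_apply] at h1
    have e2 : (((x⁻¹ : H) : GL (Fin p) K)⁻¹ : GL (Fin p) K) = (x : GL (Fin p) K) := by
      rw [Subgroup.coe_inv, inv_inv]
    rw [e2] at h1
    rw [e1, Subgroup.coe_mul, Subgroup.coe_mul, Units.val_mul, Units.val_mul]
    exact h1
  rw [hdecomp, Subgroup.coe_mul, Units.val_mul, hsmat, Matrix.smul_mul, Matrix.one_mul]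
  exact Submodule.smul_mem _ c humem

end WeakAdequacyCriterion

end PrimeDegreeClifford

section ResidualPow

/-- **The residual hypothesis of Theorem 1.7 for `p ∥ |G|`, in its sharpest form.**  The named
fact follows from: (1) for odd `p`, `K = K̄`, a faithful irreducible primitive `τ : G →* GL_p(K)`
with its simple socle-layer `L` and `p² ∤ |G|`: for every `y ∈ τ(G)` of order `p` (a regular
unipotent, `Subgroup.exists_cyclicBasis_of_isIrreducible`), ALL POWERS `y^j` LIE IN THE `K`-SPAN OF
THE `p'`-ELEMENTS of `τ(G)` — which by
`PrimeDegreeClifford.semisimpleSpan_eq_top_iff_forall_pow_mem` is weak adequacy, clauses (i), (ii)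
being proved (`Subgroup.addMonoidHom_eq_zero_and_cocycles₁_le_of_primitive_of_not_sq_dvd`); and
(2) "(a) or (`p = 3`, `L ≅ A₆`, `τ(G) ≤ L · Z`)" when `p² ∣ |G|`.  Both remain inputs of GHT
Theorem 2.2 (CFSG) with Props. 6.7–6.14 ([GHT15, Prop. 3.1] for `PSL₂(p)`), Cor. 9.4–9.5; NOT in
the tree. [cite: GuralnickHerzigTiep2017, Theorem 6.15 (proof, p. 24), Lemma 6.2, Theorem 2.2] -/
theorem ght2017_adequate_or_index_p_or_psl29_of_socle_odd_pow
    (hw : ∀ (p : ℕ) [Fact p.Prime] (K : Type u) [Field K] [IsAlgClosed K] [CharP K p]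
      (G : Type v) [Group G] [Finite G] (τ : G →* GL (Fin p) K),
      p ≠ 2 → Function.Injective τ → (glRepresentation τ).IsIrreducible →
      (∀ (b : Module.Basis (Fin p) K (Fin p → K)) (θ : ↥τ.range →* Equiv.Perm (Fin p)),
        (∀ (h : τ.range) (i : Fin p), ∃ c : K,
          ((h : GL (Fin p) K) : Matrix (Fin p) (Fin p) K) *ᵥ b i = c • b (θ h i)) →
        θ.ker ≤ Subgroup.center τ.range) →
      ∀ L : Subgroup (GL (Fin p) K), L ≤ τ.range → (∀ h ∈ τ.range, ∀ x ∈ L, h * x * h⁻¹ ∈ L) →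
        (∀ N : Subgroup (GL (Fin p) K), N ≤ τ.range → (∀ h ∈ τ.range, ∀ x ∈ N, h * x * h⁻¹ ∈ N) →
          (∀ x ∈ N, ∃ c : K, ((x : GL (Fin p) K) : Matrix (Fin p) (Fin p) K) = c • 1) ∨ L ≤ N) →
        (∀ g ∈ τ.range, (∀ x ∈ L, g * x * g⁻¹ = x) →
          ∃ c : K, ((g : GL (Fin p) K) : Matrix (Fin p) (Fin p) K) = c • 1) →
        (glRepresentation L.subtype).IsIrreducible →
        (∀ x ∈ L, Matrix.det ((x : GL (Fin p) K) : Matrix (Fin p) (Fin p) K) = 1) →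
        IsSimpleGroup L → p ∣ Nat.card L → ¬p ^ 2 ∣ Nat.card G →
        ∀ y : ↥τ.range, orderOf y = p → ∀ j : ℕ,
          (((y ^ j : ↥τ.range) : GL (Fin p) K) : Matrix (Fin p) (Fin p) K) ∈
            Subgroup.semisimpleSpan τ.range)
    (hs : ∀ (p : ℕ) [Fact p.Prime] (K : Type u) [Field K] [IsAlgClosed K] [CharP K p]
      (G : Type v) [Group G] [Finite G] (τ : G →* GL (Fin p) K),
      p ≠ 2 → Function.Injective τ → (glRepresentation τ).IsIrreducible →
      (∀ (b : Module.Basis (Fin p) K (Fin p → K)) (θ : ↥τ.range →* Equiv.Perm (Fin p)),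
        (∀ (h : τ.range) (i : Fin p), ∃ c : K,
          ((h : GL (Fin p) K) : Matrix (Fin p) (Fin p) K) *ᵥ b i = c • b (θ h i)) →
        θ.ker ≤ Subgroup.center τ.range) →
      ∀ L : Subgroup (GL (Fin p) K), L ≤ τ.range → (∀ h ∈ τ.range, ∀ x ∈ L, h * x * h⁻¹ ∈ L) →
        (∀ N : Subgroup (GL (Fin p) K), N ≤ τ.range → (∀ h ∈ τ.range, ∀ x ∈ N, h * x * h⁻¹ ∈ N) →
          (∀ x ∈ N, ∃ c : K, ((x : GL (Fin p) K) : Matrix (Fin p) (Fin p) K) = c • 1) ∨ L ≤ N) →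
        (∀ g ∈ τ.range, (∀ x ∈ L, g * x * g⁻¹ = x) →
          ∃ c : K, ((g : GL (Fin p) K) : Matrix (Fin p) (Fin p) K) = c • 1) →
        (glRepresentation L.subtype).IsIrreducible →
        (∀ x ∈ L, Matrix.det ((x : GL (Fin p) K) : Matrix (Fin p) (Fin p) K) = 1) →
        IsSimpleGroup L → p ∣ Nat.card L → p ^ 2 ∣ Nat.card G →
        Subgroup.IsExtendedAdequate τ.range ∨
          (p = 3 ∧ Nonempty (↥L ≃* ↥(alternatingGroup (Fin 6))) ∧
            τ.range ≤ L ⊔ Subgroup.center (GL (Fin p) K))) :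
    ght2017_adequate_or_index_p_or_psl29.{u, v} := by
  refine ght2017_adequate_or_index_p_or_psl29_of_socle_odd_sq
    (fun p _ K _ _ _ G _ _ τ hp hinj hirr hmono L hLH hLnorm hsocle hcent hirrL hdet hsimple hdvd h2 =>
      ?_) hs
  haveI : Finite τ.range := Finite.of_surjective _ τ.rangeRestrict_surjective
  have hcard : Nat.card τ.range = Nat.card G :=
    (Nat.card_congr (MonoidHom.ofInjective hinj).toEquiv).symm
  have hp2 : ¬p ^ 2 ∣ Nat.card τ.range := by rwa [hcard]
  -- a `p`-element of `τ(G)` (Cauchy, `p ∣ |L| ∣ |τ(G)|`)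
  have hdvd' : p ∣ Nat.card τ.range := hdvd.trans (Subgroup.card_dvd_of_le hLH)
  obtain ⟨y, hy⟩ := exists_prime_orderOf_dvd_card' p hdvd'
  -- Burnside: `τ(G)` spans `M_p(K)`
  haveI := isIrreducible_range_subtype τ hirr
  have hspan : Submodule.span K (Set.range fun h : τ.range =>
      ((h : GL (Fin p) K) : Matrix (Fin p) (Fin p) K)) = ⊤ :=
    Literature.RepresentationTheory.Semisimple.span_eq_top_of_isIrreducible τ.range.subtype
  exact (PrimeDegreeClifford.semisimpleSpan_eq_top_iff_forall_pow_mem hspan hp2 y hy).2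
    (hw p K G τ hp hinj hirr hmono L hLH hLnorm hsocle hcent hirrL hdet hsimple hdvd h2 y hy)

end ResidualPow

/-! ## For `p ∥ |G|` Theorem 1.7 is "(a) or (b)"

Alternative (c) makes the image of `G` in `PGL_p` a group of order `|A₆| = 360`, so `9 ∣ |G|`;
for `p² ∤ |G|` the disjunction of the named fact is therefore "(a) or (b)", of which everything
but clause (iii) is proved above. -/

section AlternativeCNeedsNine

/-- **Alternative (c) of Theorem 1.7 forces `9 ∣ |G|`:** if the image of `σ(G)` in `PGL_p(k)` is
isomorphic to `A₆` then `360 ∣ |G|`, in particular `p² = 9 ∣ |G|` when `p = 3`.  (The image is a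
quotient of a quotient of `G`; `|A₆| = 360` is `AltSixPSL.natCard_alternatingGroup`.)  Hence for `p ∥ |G|`
Theorem 1.7 reads "(a) or (b)". [folklore] -/
theorem dvd_card_of_nonempty_mulEquiv_alternatingGroup {p : ℕ} {k : Type u} [Field k]
    {G : Type v} [Group G] [Finite G] (σ : G →* GL (Fin p) k)
    (h : Nonempty (↥(σ.range.map (QuotientGroup.mk' (Subgroup.center (GL (Fin p) k)))) ≃*
      ↥(alternatingGroup (Fin 6)))) :
    360 ∣ Nat.card G := by
  obtain ⟨e⟩ := h
  rw [← Literature.GroupTheory.SpecificGroups.AltSixPSL.natCard_alternatingGroup,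
    ← Nat.card_congr e.toEquiv]
  exact (Subgroup.card_map_dvd _ _).trans (Subgroup.card_range_dvd σ)

/-- For `p² ∤ |G|`, alternative (c) of Theorem 1.7 does not occur. [folklore] -/
theorem not_alternativeC_of_not_sq_dvd {p : ℕ} {k : Type u} [Field k] {G : Type v} [Group G]
    [Finite G] (σ : G →* GL (Fin p) k) (hp2 : ¬p ^ 2 ∣ Nat.card G) :
    ¬(p = 3 ∧ Nonempty (↥(σ.range.map (QuotientGroup.mk' (Subgroup.center (GL (Fin p) k)))) ≃*
      ↥(alternatingGroup (Fin 6)))) := by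
  rintro ⟨rfl, h⟩
  exact hp2 ((show (3 ^ 2 : ℕ) ∣ 360 by decide).trans
    (dvd_card_of_nonempty_mulEquiv_alternatingGroup σ h))

/-- **Theorem 1.7 for `p ∥ |G|` is "(a) or (b)", and it holds granted weak adequacy.**  For a
faithful absolutely irreducible `σ : G →* GL_p(k)` (`char k = p`) with `p² ∤ |G|`, the
disjunction "(a) ∨ (b) ∨ (c)" of the named fact `ght2017_adequate_or_index_p_or_psl29` is
equivalent to "(a) ∨ (b)" (`not_alternativeC_of_not_sq_dvd`), of which clauses (i), (ii) of (a),
or (b), are PROVED (`addMonoidHom_eq_zero_and_cocycles₁_le_or_index_p_of_not_sq_dvd`); what is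
missing is clause (iii) alone. [cite: GuralnickHerzigTiep2017, Theorem 1.7] -/
theorem ght2017_disjunction_iff_of_not_sq_dvd {p : ℕ} [Fact p.Prime] {k : Type u} [Field k]
    [CharP k p] {G : Type v} [Group G] [Finite G] (σ : G →* GL (Fin p) k)
    (hp2 : ¬p ^ 2 ∣ Nat.card G) :
    (Subgroup.IsExtendedAdequate σ.range ∨
      (∃ A : Subgroup G, A.Normal ∧ (∀ x ∈ A, ∀ y ∈ A, x * y = y * x) ∧ A.index = p) ∨
      (p = 3 ∧ Nonempty (↥(σ.range.map (QuotientGroup.mk' (Subgroup.center (GL (Fin p) k)))) ≃*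
        ↥(alternatingGroup (Fin 6))))) ↔
    (Subgroup.IsExtendedAdequate σ.range ∨
      ∃ A : Subgroup G, A.Normal ∧ (∀ x ∈ A, ∀ y ∈ A, x * y = y * x) ∧ A.index = p) := by
  constructor
  · rintro (h | h | h)
    · exact Or.inl h
    · exact Or.inr h
    · exact absurd h (not_alternativeC_of_not_sq_dvd σ hp2)
  · rintro (h | h)
    · exact Or.inl h
    · exact Or.inr (Or.inl h)

end AlternativeCNeedsNine

end Literature.NumberTheory.GaloisRepresentations
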